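/-
Copyright (c) 2026. All rights reserved.
Released under Apache 2.0 license as described in the file LICENSE.
-/
import Literature.Geometry.Kaehler.ComplexTorusQuaternionXSixSpecialPointsBurnside
import HarnessLib

/-!
# The points of `Z(t)` on the three intermediate Atkin–Lehner quotients `X₆^{(d)} = X₆/⟨ω_d⟩`, `d = 2, 3, 6`, for EVERY
# `t > 0`: `#(Pt(t)/Γ₆) + #((Pt(t) ∩ Pt(t_d))/Γ₆) = 2·#(Pt(t)/Γ₆^{(d)})` with `t₂ = 1`, `t₃ = 3`, `t₆ = 6`, and the ten-value
# tables `2,1,1,2,2,2,2,2,4,3` ∕ `1,2,1,2,2,2,2,2,3,4` ∕ `1,1,2,2,2,2,2,2,3,3`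

[tag: complex_torus] [tag: abelian_surface] [tag: quaternion_multiplication] [tag: complex_multiplication]
[tag: shimura_curve] [tag: special_cycles] [tag: atkin_lehner] [tag: elliptic_points]

Setting of the `…XSix…` files (`B = (−1,3)_ℚ`, `𝔬`, the maximal order `O₆` as a predicate, `Γ₆ = O₆¹`,
`Pt(t) = {τ ∈ ℌ : ρ(x)τ = τ for some x ∈ 𝔬, tr x = 0, nr x = t}`, `N(O₆) = ℚ^×O₆^{±1}{1, w₂, μ, w₂μ}` with `w₂ = 1 + i`,
`μ = 3 + j + ij` of norms `2, 3`). Between `X₆ = Γ₆∖ℌ` and `X₆⁺ = Γ₆⁺∖ℌ` lie the three curves `X₆^{(d)} = Γ₆^{(d)}∖ℌ`,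
`Γ₆^{(d)} = ⟨Γ₆, w_d⟩ℚ^× = {g ∈ N(O₆) : nr g ∈ ℚ^{×2} ∪ d·ℚ^{×2}}` (Bayer–Travesa's `X₆^{(2)}, X₆^{(3)}, X₆^{(6)}`). This file
counts the points of `Z(t)` on them, for every `t > 0`, by Burnside for the involution `[τ] ↦ [ρ(w_d)τ]` of `Pt(t)/Γ₆`
(`…XSixSpecialPointsBurnside`: its fixed classes are the `Z(t_d)`-points, `t₂ = 1`, `t₃ = 3`, `t₆ = 6`):

* `atkinLehnerQuotient_equivalence`, `atkinLehnerQuotient_mk_eq_iff` (§1): for any `d`, `Γ₆^{(d)}`-equivalence of points —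
  `∃ g ≠ 0`, `gO₆ ⊆ O₆g`, `nr g > 0`, `nr g = s²` or `d·s²`, `ρ(g)p = q` — is an equivalence relation.
* `card_specialPoints_add_card_inter_eq_two_mul_card_atkinLehnerQuotientTwo` ∕ `…Three` ∕ `…Six` (§2): **FOR EVERY `t > 0`,
  `#(Pt(t)/Γ₆) + #((Pt(t) ∩ Pt(t_d))/Γ₆) = 2·#(Pt(t)/Γ₆^{(d)})`** — the double cover `X₆ → X₆^{(d)}` over the support of `Z(t)`:
  the involution `[ρ(w_d)·]` (`w_d² = d·u_d`, `u_d ∈ Γ₆`: `w₂² = 2i`, `μ² = 3(5 + 2j + 2ij)`, `(w₂μ)² = 6(2 + 3i + 2ij)`) has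
  orbit space `Pt(t)/Γ₆^{(d)}` (exhaustion of `N(O₆)` and «`2, 3, 6, 3/2, 2/3, 1/2, 1/3` are not rational squares») and fixed
  classes the `Z(t_d)`-points.
* §3, closed forms: `card_specialPoints_eq_two_mul_card_atkinLehnerQuotient{Two,Three,Six}_of_not` (`t ∉ ℚ²·t_d`:
  `#(Pt(t)/Γ₆) = 2·#(Pt(t)/Γ₆^{(d)})`, `ω_d` free on `Z(t)`) and `card_specialPoints_add_two_eq_two_mul_…_of_sq_mul`
  (`t = t_d m²`: `#(Pt(t)/Γ₆) + 2 = 2·#(Pt(t)/Γ₆^{(d)})`).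
* §4, THE TEN-VALUE TABLES for `t = 1, 3, 6, 10, 13, 19, 21, 22, 25, 75` (`card_atkinLehnerQuotientTwo_table`, `…Three_table`,
  `…Six_table`): **`X₆^{(2)}`: `2, 1, 1, 2, 2, 2, 2, 2, 4, 3`; `X₆^{(3)}`: `1, 2, 1, 2, 2, 2, 2, 2, 3, 4`; `X₆^{(6)}`:
  `1, 1, 2, 2, 2, 2, 2, 2, 3, 3`** — against `2, 2, 2, 4, 4, 4, 4, 4, 6, 6` on `X₆` (`card_specialPoints_table`) and
  `1, 1, 1, 1, 1, 1, 1, 1, 2, 2` on `X₆⁺` (`card_specialPointsPlus_table_ten`): `Z(1)` keeps its two points on `X₆^{(2)}` (`ω₂`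
  fixes `P₆, P₁₃₅`) and becomes one point on `X₆^{(3)}`, `X₆^{(6)}`; symmetrically for `Z(3)`, `Z(6)`.

## The print

* P. Bayer, A. Travesa (2007), §2 p. 318: «Its classes are represented by elements `w_d ∈ O₆` of norm `d` dividing `D = 6`.
  They give rise to involutions of the curve `X₆`, denoted `ω_d` … we shall also consider the quotient curves
  `X₆^{(2)} = X₆/⟨ω₂⟩`, `X₆^{(3)} = X₆/⟨ω₃⟩`, `X₆^{(6)} = X₆/⟨ω₆⟩` and `X₆⁺ = X₆/W`»; §7 p. 332: «`P₀` is an elliptic point for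
  `X₆^{(6)}` and `X₆⁺`, but it is not elliptic for `X₆`, `X₆^{(2)}` and `X₆^{(3)}`»; Table 9. [cite: BayerTravesa2007, §2, §7 and Table 9]
* A. P. Ogg (1983), §2 (3)–(4): the genus of `X/⟨w(m)⟩` from the number of fixed points of `w(m)` (Riemann–Hurwitz for the
  double cover `X → X/⟨w(m)⟩`). [cite: Ogg1983RealPoints, §2]
* S. Kudla, M. Rapoport, T. Yang (2006), §3.4 Remark 3.4.7 and (3.4.13). [cite: KudlaRapoportYang2006, §3.4 Remark 3.4.7]
* M.-F. Vignéras (1980), Ch. IV §3 B. [cite: VignerasLNM800, Ch. IV §3 B]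

## Scope (honest)

Theorems only — no definitions, no named facts, no instances; relations inline, quotients bare `Quot`s; the involution and
Burnside's lemma live inside a private counting lemma (the Klein-four lemma of `…XSixSpecialPointsBurnside` with one
generator trivial). Nothing identifies `Pt(t)/Γ₆^{(d)}` with the points of an algebraic model of `X₆^{(d)}`; genera and
Riemann–Hurwitz are not touched.
-/

noncomputable section

set_option maxSynthPendingDepth 3

open Quaternion Function

namespace Literature.Geometry.Kaehler.ComplexTorus.QuaternionType

/-! ## §0 Helpers -/

section Helpers

/-- `ρ(1)` acts trivially. [folklore] -/
private theorem moebius_rho_castQ_one₁₃ (τ : ℂ) :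
    moebius (rho (-1) 3 (by norm_num) (castQ (-1) 3 (1 : ℍ[ℚ,((-1 : ℤ) : ℚ),((3 : ℤ) : ℚ)]))) τ = τ := by
  rw [castQ_one, map_one, moebius_apply]
  simp

/-- `ρ(wv) = ρ(w) ∘ ρ(v)` on `ℌ` for positive norms. [folklore] -/
private theorem moebius_rho_castQ_mul₁₃ {v w : ℍ[ℚ,((-1 : ℤ) : ℚ),((3 : ℤ) : ℚ)]} (hv : 0 < (v * star v).re)
    (hw : 0 < (w * star w).re) {τ : ℂ} (hτ : 0 < τ.im) :
    moebius (rho (-1) 3 (by norm_num) (castQ (-1) 3 (w * v))) τ =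
      moebius (rho (-1) 3 (by norm_num) (castQ (-1) 3 w)) (moebius (rho (-1) 3 (by norm_num) (castQ (-1) 3 v)) τ) := by
  rw [castQ_mul, map_mul]
  exact moebius_mul_of_det_pos (det_rho_castQ_pos _ hw) (det_rho_castQ_pos _ hv) (UpperHalfPlane.mk τ hτ)

/-- The product of two non-zero quaternions of `(−1,3)_ℚ` is non-zero. [folklore] -/
private theorem mul_ne_zero₁₃ {g h : ℍ[ℚ,((-1 : ℤ) : ℚ),((3 : ℤ) : ℚ)]} (hg : g ≠ 0) (hh : h ≠ 0) : g * h ≠ 0 := by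
  intro h0
  have e := re_mul_mul_star_mul g h
  rw [h0, zero_mul, QuaternionAlgebra.re_zero] at e
  exact mul_ne_zero (norm_ne_zero_of_ne_zero hg) (norm_ne_zero_of_ne_zero hh) e.symm

/-- `gO₆ ⊆ O₆g ⟹ ḡO₆ ⊆ O₆ḡ` (`N(O₆)` exhausted). [folklore] -/
private theorem normalises_star_of_left₁₃ {g : ℍ[ℚ,((-1 : ℤ) : ℚ),((3 : ℤ) : ℚ)]} (hg0 : g ≠ 0)
    (hL : (∀ a : ℍ[ℚ,((-1 : ℤ) : ℚ),((3 : ℤ) : ℚ)], (a ∈ order (-1) 3 ∨ a - ⟨1/2, 1/2, 1/2, -1/2⟩ ∈ order (-1) 3) →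
      ∃ b : ℍ[ℚ,((-1 : ℤ) : ℚ),((3 : ℤ) : ℚ)], (b ∈ order (-1) 3 ∨ b - ⟨1/2, 1/2, 1/2, -1/2⟩ ∈ order (-1) 3) ∧ g * a = b * g)) :
    ∀ a : ℍ[ℚ,((-1 : ℤ) : ℚ),((3 : ℤ) : ℚ)], (a ∈ order (-1) 3 ∨ a - ⟨1/2, 1/2, 1/2, -1/2⟩ ∈ order (-1) 3) →
      ∃ b : ℍ[ℚ,((-1 : ℤ) : ℚ),((3 : ℤ) : ℚ)], (b ∈ order (-1) 3 ∨ b - ⟨1/2, 1/2, 1/2, -1/2⟩ ∈ order (-1) 3) ∧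
        star g * a = b * star g := by
  obtain ⟨q, v, k, l, -, hv, h1, -, -, hg⟩ := (normalises_maxOrder_iff_exists' hg0).1 hL
  have hR := (normalises_of_eq_smul_unit_mul_atkinLehner hv h1 k l hg).2.2
  intro a ha
  obtain ⟨c, hc, e⟩ := hR (star a) (star_maxOrder ha)
  refine ⟨star c, star_maxOrder hc, ?_⟩
  have e' := congrArg star e
  rwa [star_mul, star_star, star_mul] at e'

/-- Norms of the Atkin–Lehner words `w₂^k μ^l`, `k, l ≤ 1`: `2^k 3^l`. [folklore] -/
private theorem norm_atkinLehner_word₁₃ (k l : ℕ) (hk : k ≤ 1) (hl : l ≤ 1) :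
    (((⟨1, 1, 0, 0⟩ : ℍ[ℚ,((-1 : ℤ) : ℚ),((3 : ℤ) : ℚ)]) ^ k * ⟨3, 0, 1, 1⟩ ^ l) *
        star ((⟨1, 1, 0, 0⟩ : ℍ[ℚ,((-1 : ℤ) : ℚ),((3 : ℤ) : ℚ)]) ^ k * ⟨3, 0, 1, 1⟩ ^ l)).re = 2 ^ k * 3 ^ l := by
  have hnm : ((⟨3, 0, 1, 1⟩ : ℍ[ℚ,((-1 : ℤ) : ℚ),((3 : ℤ) : ℚ)]) * star ⟨3, 0, 1, 1⟩).re = 3 := by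
    rw [QuaternionAlgebra.star_mk, QuaternionAlgebra.mk_mul_mk]; norm_num
  have hnw : ((⟨1, 1, 0, 0⟩ : ℍ[ℚ,((-1 : ℤ) : ℚ),((3 : ℤ) : ℚ)]) * star ⟨1, 1, 0, 0⟩).re = 2 := by
    rw [QuaternionAlgebra.star_mk, QuaternionAlgebra.mk_mul_mk]; norm_num
  rcases Nat.le_one_iff_eq_zero_or_eq_one.1 hk with rfl | rfl <;>
    rcases Nat.le_one_iff_eq_zero_or_eq_one.1 hl with rfl | rfl
  · rw [pow_zero, pow_zero, mul_one, star_one, mul_one, QuaternionAlgebra.re_one]; norm_num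
  · rw [pow_zero, pow_one, one_mul, hnm]; norm_num
  · rw [pow_one, pow_zero, mul_one, hnw]; norm_num
  · rw [pow_one, pow_one, re_mul_mul_star_mul, hnw, hnm]; norm_num

/-- `a·q² = b·s²` with `q ≠ 0 ≠ b` makes `a/b` a rational square. [folklore] -/
private theorem isSquare_div_of_mul_sq_eq₁₃ {a b q s : ℚ} (hq : q ≠ 0) (hb : b ≠ 0) (h : q ^ 2 * a = b * s ^ 2) :
    IsSquare (a / b) := by
  refine ⟨s / q, ?_⟩
  field_simp
  linear_combination h

/-- `t = c²·t₀` (`c ∈ ℚ`) makes `t/t₀` a rational square (`t₀ ≠ 0`). [folklore] -/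
private theorem not_exists_eq_sq_mul₁₃ {t t₀ : ℚ} (ht₀ : t₀ ≠ 0) (h : ¬ IsSquare (t / t₀)) :
    ¬ ∃ c : ℚ, t = c ^ 2 * t₀ := by
  rintro ⟨c, hc⟩
  refine h ⟨c, ?_⟩
  rw [hc]
  field_simp

/-- Iterates of an involution depend only on the parity of the exponent. [folklore] -/
private theorem iterate_mod_two₁₃ {Q : Type*} {ν : Q → Q} (hνν : ∀ q, ν (ν q) = q) (n : ℕ) (q : Q) :
    ν^[n] q = ν^[n % 2] q := by
  induction n using Nat.strong_induction_on with
  | _ n ih =>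
    rcases Nat.lt_or_ge n 2 with h | h
    · rw [Nat.mod_eq_of_lt h]
    · obtain ⟨m, rfl⟩ : ∃ m, n = m + 2 := ⟨n - 2, by omega⟩
      rw [Function.iterate_add_apply, show ν^[2] q = q from hνν q, Nat.add_mod_right]
      exact ih m (by omega)

/-- **Burnside for one involution** (the Klein-four lemma of `…XSixSpecialPointsBurnside` with `π` trivial): an involution
`ν` of a finite set `Q` and a surjection `f` onto `Q'` with fibres `{q, νq}` satisfy `|Q| + |Fix ν| = 2·|Q'|`. [folklore] -/
private theorem card_add_card_fixed_eq_two_mul_card₁₃ {Q Q' : Type*} [Finite Q] (ν : Q → Q)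
    (hνν : ∀ q, ν (ν q) = q) (f : Q → Q') (hf : Function.Surjective f) (hfν : ∀ q, f (ν q) = f q)
    (hff : ∀ q₁ q₂, f q₁ = f q₂ → q₁ = q₂ ∨ q₁ = ν q₂) :
    Nat.card Q + Nat.card {q // ν q = q} = 2 * Nat.card Q' := by
  classical
  haveI : Fintype Q := Fintype.ofFinite Q
  letI vadd : VAdd (ZMod 2) Q := ⟨fun g q ↦ ν^[g.val] q⟩
  have vadd_def : ∀ (g : ZMod 2) (q : Q), g +ᵥ q = ν^[g.val] q := fun _ _ ↦ rfl
  letI act : AddAction (ZMod 2) Q :=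
    { zero_vadd := fun q ↦ by simp [vadd_def]
      add_vadd := by
        intro a b q
        simp only [vadd_def, ZMod.val_add]
        rw [← iterate_mod_two₁₃ hνν, Function.iterate_add_apply] }
  have key := AddAction.sum_card_fixedBy_eq_card_orbits_mul_card_addGroup (ZMod 2) Q
  simp only [Fintype.card_eq_nat_card] at key
  have h0 : Nat.card (AddAction.fixedBy Q (0 : ZMod 2)) = Nat.card Q :=
    Nat.card_congr (Equiv.subtypeUnivEquiv (fun q ↦ (AddAction.mem_fixedBy).2 (zero_vadd _ q)))
  have h1 : Nat.card (AddAction.fixedBy Q (1 : ZMod 2)) = Nat.card {q // ν q = q} :=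
    Nat.card_congr (Equiv.subtypeEquivRight (fun q ↦ by rw [AddAction.mem_fixedBy, vadd_def]; rfl))
  have huniv : (Finset.univ : Finset (ZMod 2)) = {0, 1} := by decide
  rw [huniv, Finset.sum_insert (by decide), Finset.sum_singleton, h0, h1] at key
  -- the orbits are the fibres of `f`
  have horb : ∀ a b : Q, (AddAction.orbitRel (ZMod 2) Q) a b ↔ f a = f b := by
    intro a b
    rw [AddAction.orbitRel_apply, AddAction.mem_orbit_iff]
    constructor
    · rintro ⟨i, rfl⟩
      rw [vadd_def]
      fin_cases i
      · rfl
      · exact hfν b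
    · intro h
      rcases hff a b h with h | h
      · exact ⟨0, by rw [vadd_def, h]; rfl⟩
      · exact ⟨1, by rw [vadd_def, h]; rfl⟩
  have hlift : ∀ a b : Q, (AddAction.orbitRel (ZMod 2) Q) a b → f a = f b := fun a b h ↦ (horb a b).1 h
  have hbij : Function.Bijective (Quotient.lift f hlift : AddAction.orbitRel.Quotient (ZMod 2) Q → Q') := by
    constructor
    · intro x y
      induction x using Quotient.inductionOn with
      | _ a =>
        induction y using Quotient.inductionOn with
        | _ b =>
          intro h
          exact Quotient.sound ((horb a b).2 h)
    · intro q'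
      obtain ⟨q, rfl⟩ := hf q'
      exact ⟨Quotient.mk _ q, rfl⟩
  have hQ' : Nat.card (AddAction.orbitRel.Quotient (ZMod 2) Q) = Nat.card Q' :=
    Nat.card_congr (Equiv.ofBijective _ hbij)
  have hG : Nat.card (ZMod 2) = 2 := by simp
  rw [hQ', hG] at key
  omega

end Helpers

/-! ## §1 `Γ₆^{(d)}`-equivalence of points -/

section Relation

/-- **`Γ₆^{(d)}`-EQUIVALENCE IS AN EQUIVALENCE RELATION on `Pt(t)`** (any `d`): `Γ₆^{(d)} = {g ∈ N(O₆)⁺ : nr g ∈ ℚ^{×2} ∪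
d·ℚ^{×2}}` is a group — norms multiply, `{1, d}` is a subgroup of `ℚ^×/ℚ^{×2}`, and `nr ḡ = nr g`. For `d = 2, 3, 6` this is
Bayer–Travesa's `⟨Γ₆, w_d⟩` (modulo `ℚ^×`). [cite: BayerTravesa2007, §2 p. 318 («`X₆^{(2)} = X₆/⟨ω₂⟩, X₆^{(3)} = X₆/⟨ω₃⟩, X₆^{(6)} = X₆/⟨ω₆⟩`»)] [cite: VignerasLNM800, Ch. IV §3 B] -/
theorem atkinLehnerQuotient_equivalence (t : ℤ) (d : ℚ) :
    Equivalence (fun p q : {τ : ℂ // 0 < τ.im ∧ ∃ x : ℍ[ℚ,((-1 : ℤ) : ℚ),((3 : ℤ) : ℚ)],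
        x ∈ order (-1) 3 ∧ x.re = 0 ∧ (x * star x).re = t ∧ moebius (rho (-1) 3 (by norm_num) (castQ (-1) 3 x)) τ = τ} ↦
      ∃ g : ℍ[ℚ,((-1 : ℤ) : ℚ),((3 : ℤ) : ℚ)], g ≠ 0 ∧
        (∀ a : ℍ[ℚ,((-1 : ℤ) : ℚ),((3 : ℤ) : ℚ)], (a ∈ order (-1) 3 ∨ a - ⟨1/2, 1/2, 1/2, -1/2⟩ ∈ order (-1) 3) →
          ∃ b : ℍ[ℚ,((-1 : ℤ) : ℚ),((3 : ℤ) : ℚ)], (b ∈ order (-1) 3 ∨ b - ⟨1/2, 1/2, 1/2, -1/2⟩ ∈ order (-1) 3) ∧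
            g * a = b * g) ∧
        0 < (g * star g).re ∧ (∃ s : ℚ, (g * star g).re = s ^ 2 ∨ (g * star g).re = d * s ^ 2) ∧
        moebius (rho (-1) 3 (by norm_num) (castQ (-1) 3 g)) p.1 = q.1) where
  refl p := ⟨1, one_ne_zero, fun a ha ↦ ⟨a, ha, by rw [one_mul, mul_one]⟩,
    by rw [star_one, mul_one, QuaternionAlgebra.re_one]; exact one_pos,
    ⟨1, Or.inl (by rw [star_one, mul_one, QuaternionAlgebra.re_one]; norm_num)⟩, moebius_rho_castQ_one₁₃ _⟩
  symm := by
    rintro p q ⟨g, hg0, hL, hn, hs, h⟩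
    refine ⟨star g, star_ne_zero.2 hg0, normalises_star_of_left₁₃ hg0 hL,
      by rw [star_star, star_comm_self' g]; exact hn, by rw [star_star, star_comm_self' g]; exact hs, ?_⟩
    rw [← h]
    exact moebius_rho_star_moebius_rho (by norm_num) hn (UpperHalfPlane.mk p.1 p.2.1)
  trans := by
    rintro p q r ⟨g, hg0, hgL, hgn, ⟨s, hs⟩, hg⟩ ⟨h, hh0, hhL, hhn, ⟨s', hs'⟩, hh⟩
    refine ⟨h * g, mul_ne_zero₁₃ hh0 hg0, fun a ha ↦ ?_,
      by rw [re_mul_mul_star_mul]; exact mul_pos hhn hgn, ?_, ?_⟩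
    · obtain ⟨b, hb, eb⟩ := hgL a ha
      obtain ⟨c, hc, ec⟩ := hhL b hb
      exact ⟨c, hc, by rw [mul_assoc, eb, ← mul_assoc, ec, mul_assoc]⟩
    · rw [re_mul_mul_star_mul]
      rcases hs with hs | hs <;> rcases hs' with hs' | hs' <;> rw [hs, hs']
      · exact ⟨s' * s, Or.inl (by ring)⟩
      · exact ⟨s' * s, Or.inr (by ring)⟩
      · exact ⟨s' * s, Or.inr (by ring)⟩
      · exact ⟨d * s' * s, Or.inl (by ring)⟩
    · rw [moebius_rho_castQ_mul₁₃ hgn hhn p.2.1, hg, hh]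

/-- Equality of `Γ₆^{(d)}`-classes of points iff `Γ₆^{(d)}`-equivalent. [cite: BayerTravesa2007, §2] -/
theorem atkinLehnerQuotient_mk_eq_iff (t : ℤ) (d : ℚ) (p q : {τ : ℂ // 0 < τ.im ∧ ∃ x : ℍ[ℚ,((-1 : ℤ) : ℚ),((3 : ℤ) : ℚ)],
        x ∈ order (-1) 3 ∧ x.re = 0 ∧ (x * star x).re = t ∧ moebius (rho (-1) 3 (by norm_num) (castQ (-1) 3 x)) τ = τ}) :
    Quot.mk (fun p q : {τ : ℂ // 0 < τ.im ∧ ∃ x : ℍ[ℚ,((-1 : ℤ) : ℚ),((3 : ℤ) : ℚ)],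
        x ∈ order (-1) 3 ∧ x.re = 0 ∧ (x * star x).re = t ∧ moebius (rho (-1) 3 (by norm_num) (castQ (-1) 3 x)) τ = τ} ↦
      ∃ g : ℍ[ℚ,((-1 : ℤ) : ℚ),((3 : ℤ) : ℚ)], g ≠ 0 ∧
        (∀ a : ℍ[ℚ,((-1 : ℤ) : ℚ),((3 : ℤ) : ℚ)], (a ∈ order (-1) 3 ∨ a - ⟨1/2, 1/2, 1/2, -1/2⟩ ∈ order (-1) 3) →
          ∃ b : ℍ[ℚ,((-1 : ℤ) : ℚ),((3 : ℤ) : ℚ)], (b ∈ order (-1) 3 ∨ b - ⟨1/2, 1/2, 1/2, -1/2⟩ ∈ order (-1) 3) ∧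
            g * a = b * g) ∧
        0 < (g * star g).re ∧ (∃ s : ℚ, (g * star g).re = s ^ 2 ∨ (g * star g).re = d * s ^ 2) ∧
        moebius (rho (-1) 3 (by norm_num) (castQ (-1) 3 g)) p.1 = q.1) p = Quot.mk _ q ↔
      ∃ g : ℍ[ℚ,((-1 : ℤ) : ℚ),((3 : ℤ) : ℚ)], g ≠ 0 ∧
        (∀ a : ℍ[ℚ,((-1 : ℤ) : ℚ),((3 : ℤ) : ℚ)], (a ∈ order (-1) 3 ∨ a - ⟨1/2, 1/2, 1/2, -1/2⟩ ∈ order (-1) 3) →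
          ∃ b : ℍ[ℚ,((-1 : ℤ) : ℚ),((3 : ℤ) : ℚ)], (b ∈ order (-1) 3 ∨ b - ⟨1/2, 1/2, 1/2, -1/2⟩ ∈ order (-1) 3) ∧
            g * a = b * g) ∧
        0 < (g * star g).re ∧ (∃ s : ℚ, (g * star g).re = s ^ 2 ∨ (g * star g).re = d * s ^ 2) ∧
        moebius (rho (-1) 3 (by norm_num) (castQ (-1) 3 g)) p.1 = q.1 := by
  rw [Quot.eq]
  exact (atkinLehnerQuotient_equivalence t d).eqvGen_iff

end Relation

/-! ## §2 The double covers `X₆ → X₆^{(d)}` over `Z(t)`: `#(Pt(t)/Γ₆) + #((Pt(t) ∩ Pt(t_d))/Γ₆) = 2·#(Pt(t)/Γ₆^{(d)})` -/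

section Engine

/-- **The engine**: for an Atkin–Lehner word `W = w₂^a μ^b` of norm `d = 2^a 3^b` with `W² = d·u`, `u ∈ Γ₆`, whose lifted
fixed points are the `Pt(t₀)`-points, and such that `nr g ∈ ℚ^{×2}{1, d}` singles out the words `1, W`: Burnside for the
involution `[ρ(W)·]` of `Pt(t)/Γ₆`. [folklore] -/
private theorem card_add_inter_eq_two_mul_engine₁₃ {t : ℤ} (ht : 0 < t) {d t₀ : ℚ} (W u : ℍ[ℚ,((-1 : ℤ) : ℚ),((3 : ℤ) : ℚ)])
    (a b : ℕ) (ha : a ≤ 1) (hb : b ≤ 1) (hab : (a, b) ≠ (0, 0))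
    (hW : W = ⟨1, 1, 0, 0⟩ ^ a * ⟨3, 0, 1, 1⟩ ^ b) (hd : d = 2 ^ a * 3 ^ b)
    (hu : u ∈ order (-1) 3 ∨ u - ⟨1/2, 1/2, 1/2, -1/2⟩ ∈ order (-1) 3) (hu1 : u * star u = 1) (hsq : W * W = d • u)
    (hfix : ∀ τ : ℂ, 0 < τ.im →
      ((∃ v : ℍ[ℚ,((-1 : ℤ) : ℚ),((3 : ℤ) : ℚ)], (v ∈ order (-1) 3 ∨ v - ⟨1/2, 1/2, 1/2, -1/2⟩ ∈ order (-1) 3) ∧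
          v * star v = 1 ∧ moebius (rho (-1) 3 (by norm_num) (castQ (-1) 3 v)) (moebius (rho (-1) 3 (by norm_num) (castQ (-1) 3 W)) τ) = τ) ↔
        (∃ y : ℍ[ℚ,((-1 : ℤ) : ℚ),((3 : ℤ) : ℚ)], y ∈ order (-1) 3 ∧ y.re = 0 ∧ (y * star y).re = t₀ ∧
          moebius (rho (-1) 3 (by norm_num) (castQ (-1) 3 y)) τ = τ)))
    (hexcl : ∀ k l : ℕ, k ≤ 1 → l ≤ 1 → ∀ q s : ℚ, 0 < q →
      (q ^ 2 * (2 ^ k * 3 ^ l) = s ^ 2 ∨ q ^ 2 * (2 ^ k * 3 ^ l) = d * s ^ 2) → (k = 0 ∧ l = 0) ∨ (k = a ∧ l = b)) :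
    Nat.card (Quot (fun p q : {τ : ℂ // 0 < τ.im ∧ ∃ x : ℍ[ℚ,((-1 : ℤ) : ℚ),((3 : ℤ) : ℚ)],
        x ∈ order (-1) 3 ∧ x.re = 0 ∧ (x * star x).re = t ∧ moebius (rho (-1) 3 (by norm_num) (castQ (-1) 3 x)) τ = τ} ↦
      ∃ v : ℍ[ℚ,((-1 : ℤ) : ℚ),((3 : ℤ) : ℚ)], (v ∈ order (-1) 3 ∨ v - ⟨1/2, 1/2, 1/2, -1/2⟩ ∈ order (-1) 3) ∧
        v * star v = 1 ∧ moebius (rho (-1) 3 (by norm_num) (castQ (-1) 3 v)) p.1 = q.1)) +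
    Nat.card (Quot (fun p q : {τ : ℂ // 0 < τ.im ∧ (∃ x : ℍ[ℚ,((-1 : ℤ) : ℚ),((3 : ℤ) : ℚ)],
        x ∈ order (-1) 3 ∧ x.re = 0 ∧ (x * star x).re = t ∧ moebius (rho (-1) 3 (by norm_num) (castQ (-1) 3 x)) τ = τ) ∧
        (∃ y : ℍ[ℚ,((-1 : ℤ) : ℚ),((3 : ℤ) : ℚ)], y ∈ order (-1) 3 ∧ y.re = 0 ∧ (y * star y).re = t₀ ∧
          moebius (rho (-1) 3 (by norm_num) (castQ (-1) 3 y)) τ = τ)} ↦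
      ∃ v : ℍ[ℚ,((-1 : ℤ) : ℚ),((3 : ℤ) : ℚ)], (v ∈ order (-1) 3 ∨ v - ⟨1/2, 1/2, 1/2, -1/2⟩ ∈ order (-1) 3) ∧
        v * star v = 1 ∧ moebius (rho (-1) 3 (by norm_num) (castQ (-1) 3 v)) p.1 = q.1)) =
    2 * Nat.card (Quot (fun p q : {τ : ℂ // 0 < τ.im ∧ ∃ x : ℍ[ℚ,((-1 : ℤ) : ℚ),((3 : ℤ) : ℚ)],
        x ∈ order (-1) 3 ∧ x.re = 0 ∧ (x * star x).re = t ∧ moebius (rho (-1) 3 (by norm_num) (castQ (-1) 3 x)) τ = τ} ↦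
      ∃ g : ℍ[ℚ,((-1 : ℤ) : ℚ),((3 : ℤ) : ℚ)], g ≠ 0 ∧
        (∀ a : ℍ[ℚ,((-1 : ℤ) : ℚ),((3 : ℤ) : ℚ)], (a ∈ order (-1) 3 ∨ a - ⟨1/2, 1/2, 1/2, -1/2⟩ ∈ order (-1) 3) →
          ∃ b : ℍ[ℚ,((-1 : ℤ) : ℚ),((3 : ℤ) : ℚ)], (b ∈ order (-1) 3 ∨ b - ⟨1/2, 1/2, 1/2, -1/2⟩ ∈ order (-1) 3) ∧
            g * a = b * g) ∧
        0 < (g * star g).re ∧ (∃ s : ℚ, (g * star g).re = s ^ 2 ∨ (g * star g).re = d * s ^ 2) ∧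
        moebius (rho (-1) 3 (by norm_num) (castQ (-1) 3 g)) p.1 = q.1)) := by
  set S : {τ : ℂ // 0 < τ.im ∧ ∃ x : ℍ[ℚ,((-1 : ℤ) : ℚ),((3 : ℤ) : ℚ)],
        x ∈ order (-1) 3 ∧ x.re = 0 ∧ (x * star x).re = t ∧ moebius (rho (-1) 3 (by norm_num) (castQ (-1) 3 x)) τ = τ} →
      {τ : ℂ // 0 < τ.im ∧ ∃ x : ℍ[ℚ,((-1 : ℤ) : ℚ),((3 : ℤ) : ℚ)],
        x ∈ order (-1) 3 ∧ x.re = 0 ∧ (x * star x).re = t ∧ moebius (rho (-1) 3 (by norm_num) (castQ (-1) 3 x)) τ = τ} → Prop :=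
    fun p q ↦ ∃ v : ℍ[ℚ,((-1 : ℤ) : ℚ),((3 : ℤ) : ℚ)], (v ∈ order (-1) 3 ∨ v - ⟨1/2, 1/2, 1/2, -1/2⟩ ∈ order (-1) 3) ∧
        v * star v = 1 ∧ moebius (rho (-1) 3 (by norm_num) (castQ (-1) 3 v)) p.1 = q.1 with hS
  set P : {τ : ℂ // 0 < τ.im ∧ ∃ x : ℍ[ℚ,((-1 : ℤ) : ℚ),((3 : ℤ) : ℚ)],
        x ∈ order (-1) 3 ∧ x.re = 0 ∧ (x * star x).re = t ∧ moebius (rho (-1) 3 (by norm_num) (castQ (-1) 3 x)) τ = τ} →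
      {τ : ℂ // 0 < τ.im ∧ ∃ x : ℍ[ℚ,((-1 : ℤ) : ℚ),((3 : ℤ) : ℚ)],
        x ∈ order (-1) 3 ∧ x.re = 0 ∧ (x * star x).re = t ∧ moebius (rho (-1) 3 (by norm_num) (castQ (-1) 3 x)) τ = τ} → Prop :=
    fun p q ↦ ∃ g : ℍ[ℚ,((-1 : ℤ) : ℚ),((3 : ℤ) : ℚ)], g ≠ 0 ∧
        (∀ a : ℍ[ℚ,((-1 : ℤ) : ℚ),((3 : ℤ) : ℚ)], (a ∈ order (-1) 3 ∨ a - ⟨1/2, 1/2, 1/2, -1/2⟩ ∈ order (-1) 3) →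
          ∃ b : ℍ[ℚ,((-1 : ℤ) : ℚ),((3 : ℤ) : ℚ)], (b ∈ order (-1) 3 ∨ b - ⟨1/2, 1/2, 1/2, -1/2⟩ ∈ order (-1) 3) ∧
            g * a = b * g) ∧
        0 < (g * star g).re ∧ (∃ s : ℚ, (g * star g).re = s ^ 2 ∨ (g * star g).re = d * s ^ 2) ∧
        moebius (rho (-1) 3 (by norm_num) (castQ (-1) 3 g)) p.1 = q.1 with hP
  haveI : Finite (Quot S) := finite_specialPoints ht
  have hE : Equivalence S := specialPoints_equivalence t
  have hEP : Equivalence P := atkinLehnerQuotient_equivalence t d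
  have hiff : ∀ p q, Quot.mk S p = Quot.mk S q ↔ S p q := specialPoints_mk_eq_iff t
  have hiffP : ∀ p q, Quot.mk P p = Quot.mk P q ↔ P p q := atkinLehnerQuotient_mk_eq_iff t d
  have h3' : (0 : ℤ) < 3 := by norm_num
  -- `W`: norm `d > 0`, non-zero, normalising
  have hdpos : 0 < d := by rw [hd]; positivity
  have hWn : (W * star W).re = d := by rw [hW, hd]; exact norm_atkinLehner_word₁₃ a b ha hb
  have hWpos : 0 < (W * star W).re := by rw [hWn]; exact hdpos
  have hW0 : W ≠ 0 := fun h0 ↦ by rw [h0, zero_mul, QuaternionAlgebra.re_zero] at hWn; exact hdpos.ne' (hWn ▸ rfl)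
  have h1O : ((1 : ℍ[ℚ,((-1 : ℤ) : ℚ),((3 : ℤ) : ℚ)]) ∈ order (-1) 3 ∨ (1 : ℍ[ℚ,((-1 : ℤ) : ℚ),((3 : ℤ) : ℚ)]) - ⟨1/2, 1/2, 1/2, -1/2⟩ ∈ order (-1) 3) := Or.inl (Subring.one_mem _)
  have h11 : (1 : ℍ[ℚ,((-1 : ℤ) : ℚ),((3 : ℤ) : ℚ)]) * star 1 = 1 ∨ (1 : ℍ[ℚ,((-1 : ℤ) : ℚ),((3 : ℤ) : ℚ)]) * star 1 = -1 := Or.inl (by rw [star_one, mul_one])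
  have hNW := normalises_of_eq_smul_unit_mul_atkinLehner (g := W) (q := 1) h1O h11 a b
    (by rw [hW, one_mul, one_smul])
  have hun : (u * star u).re = 1 := by rw [hu1, QuaternionAlgebra.re_one]
  -- the map on points
  have memW : ∀ p : {τ : ℂ // 0 < τ.im ∧ ∃ x : ℍ[ℚ,((-1 : ℤ) : ℚ),((3 : ℤ) : ℚ)],
        x ∈ order (-1) 3 ∧ x.re = 0 ∧ (x * star x).re = t ∧ moebius (rho (-1) 3 (by norm_num) (castQ (-1) 3 x)) τ = τ}, 0 < (moebius (rho (-1) 3 (by norm_num) (castQ (-1) 3 W)) p.1).im ∧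
      ∃ y : ℍ[ℚ,((-1 : ℤ) : ℚ),((3 : ℤ) : ℚ)], y ∈ order (-1) 3 ∧ y.re = 0 ∧ (y * star y).re = t ∧
        moebius (rho (-1) 3 (by norm_num) (castQ (-1) 3 y)) (moebius (rho (-1) 3 (by norm_num) (castQ (-1) 3 W)) p.1) = moebius (rho (-1) 3 (by norm_num) (castQ (-1) 3 W)) p.1 := by
    intro p
    obtain ⟨x, hx, hre, hxn, hfx⟩ := p.2.2
    have h3 : (0 : ℤ) < 3 := by norm_num
    refine ⟨im_moebius_rho_pos h3 hWpos p.2.1, ?_⟩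
    obtain ⟨y, hy, e⟩ := hNW.1.1 x hx
    have e2 : W * x * star W = d • y := by
      rw [e, mul_assoc]
      conv_lhs => rw [QuaternionAlgebra.mul_star_eq_coe, hWn, QuaternionAlgebra.mul_coe_eq_smul]
    have hyre : y.re = 0 := by
      have h0 := congrArg QuaternionAlgebra.re e2
      rw [re_conj_eq, hWn, hre, mul_zero, QuaternionAlgebra.re_smul, smul_eq_mul] at h0
      rcases mul_eq_zero.1 h0.symm with h1 | h1
      · exact absurd h1 hdpos.ne'
      · exact h1
    have hyn : (y * star y).re = t := by
      have hN := norm_conj_eq W x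
      rw [e2, hWn, hxn, QuaternionAlgebra.star_smul, smul_mul_smul_comm, QuaternionAlgebra.re_smul, smul_eq_mul,
        ← sq] at hN
      exact mul_left_cancel₀ (pow_ne_zero 2 hdpos.ne') hN
    refine ⟨y, hy, hyre, hyn, ?_⟩
    have hf := moebius_conj_fixed_of_im_ne_zero h3 (ε := W) (x := x) hWpos.ne' p.2.1.ne' hfx
    rw [e2, moebius_rho_castQ_smul hdpos.ne'] at hf
    exact hf
  set aW : {τ : ℂ // 0 < τ.im ∧ ∃ x : ℍ[ℚ,((-1 : ℤ) : ℚ),((3 : ℤ) : ℚ)],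
        x ∈ order (-1) 3 ∧ x.re = 0 ∧ (x * star x).re = t ∧ moebius (rho (-1) 3 (by norm_num) (castQ (-1) 3 x)) τ = τ} →
      {τ : ℂ // 0 < τ.im ∧ ∃ x : ℍ[ℚ,((-1 : ℤ) : ℚ),((3 : ℤ) : ℚ)],
        x ∈ order (-1) 3 ∧ x.re = 0 ∧ (x * star x).re = t ∧ moebius (rho (-1) 3 (by norm_num) (castQ (-1) 3 x)) τ = τ} :=
    fun p ↦ ⟨moebius (rho (-1) 3 (by norm_num) (castQ (-1) 3 W)) p.1, memW p⟩ with haW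
  -- compatibility with `Γ₆`-equivalence
  have cW : ∀ p q, S p q → S (aW p) (aW q) := by
    intro p q
    rintro ⟨v, hv, hv1, h⟩
    obtain ⟨v', hv', e⟩ := hNW.2.1 v hv
    have hvn : (v * star v).re = 1 := by rw [hv1, QuaternionAlgebra.re_one]
    have hv'n : (v' * star v').re = 1 := by
      have e2 := re_mul_mul_star_mul W v
      have e3 := re_mul_mul_star_mul v' W
      rw [e, hvn, mul_one] at e2
      rw [e2] at e3
      have e4 : (1 : ℚ) * (W * star W).re = (v' * star v').re * (W * star W).re := by rw [one_mul]; exact e3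
      exact (mul_right_cancel₀ hWpos.ne' e4).symm
    refine ⟨v', hv', mul_star_eq_one_of_re hv'n, ?_⟩
    show moebius (rho (-1) 3 (by norm_num) (castQ (-1) 3 v')) (moebius (rho (-1) 3 (by norm_num) (castQ (-1) 3 W)) p.1) = moebius (rho (-1) 3 (by norm_num) (castQ (-1) 3 W)) q.1
    rw [← moebius_rho_castQ_mul₁₃ hWpos (by rw [hv'n]; exact one_pos) p.2.1, ← e,
      moebius_rho_castQ_mul₁₃ (by rw [hvn]; exact one_pos) hWpos p.2.1, h]
  -- `Γ₆`-equivalence implies `Γ₆^{(d)}`-equivalence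
  have hSP : ∀ p q, S p q → P p q := by
    rintro p q ⟨v, hv, hv1, h⟩
    have hvn : (v * star v).re = 1 := by rw [hv1, QuaternionAlgebra.re_one]
    refine ⟨v, fun h0 ↦ by rw [h0, zero_mul, QuaternionAlgebra.re_zero] at hvn; exact zero_ne_one hvn,
      (normalises_of_eq_smul_unit_mul_atkinLehner (g := v) (q := 1) hv (Or.inl hv1) 0 0
      (by rw [pow_zero, pow_zero, mul_one, mul_one, one_smul])).2.1, by rw [hvn]; exact one_pos,
      ⟨1, Or.inl (by rw [hvn]; norm_num)⟩, h⟩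
  have key := card_add_card_fixed_eq_two_mul_card₁₃ (Quot.map aW cW) ?_
    (Quot.lift (fun p ↦ Quot.mk P p) fun p q h ↦ (hiffP p q).2 (hSP p q h)) ?_ ?_ ?_
  · -- the fixed classes are the classes of `Pt(t) ∩ Pt(t₀)`
    have hM : Nat.card {q : Quot S // Quot.map aW cW q = q} =
        Nat.card (Quot (fun p q : {τ : ℂ // 0 < τ.im ∧ (∃ x : ℍ[ℚ,((-1 : ℤ) : ℚ),((3 : ℤ) : ℚ)],
        x ∈ order (-1) 3 ∧ x.re = 0 ∧ (x * star x).re = t ∧ moebius (rho (-1) 3 (by norm_num) (castQ (-1) 3 x)) τ = τ) ∧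
        (∃ y : ℍ[ℚ,((-1 : ℤ) : ℚ),((3 : ℤ) : ℚ)], y ∈ order (-1) 3 ∧ y.re = 0 ∧ (y * star y).re = t₀ ∧
          moebius (rho (-1) 3 (by norm_num) (castQ (-1) 3 y)) τ = τ)} ↦
      ∃ v : ℍ[ℚ,((-1 : ℤ) : ℚ),((3 : ℤ) : ℚ)], (v ∈ order (-1) 3 ∨ v - ⟨1/2, 1/2, 1/2, -1/2⟩ ∈ order (-1) 3) ∧
        v * star v = 1 ∧ moebius (rho (-1) 3 (by norm_num) (castQ (-1) 3 v)) p.1 = q.1)) := by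
      symm
      refine Nat.card_eq_of_bijective
        (Quot.lift (fun r : {τ : ℂ // 0 < τ.im ∧ (∃ x : ℍ[ℚ,((-1 : ℤ) : ℚ),((3 : ℤ) : ℚ)],
        x ∈ order (-1) 3 ∧ x.re = 0 ∧ (x * star x).re = t ∧ moebius (rho (-1) 3 (by norm_num) (castQ (-1) 3 x)) τ = τ) ∧
        (∃ y : ℍ[ℚ,((-1 : ℤ) : ℚ),((3 : ℤ) : ℚ)], y ∈ order (-1) 3 ∧ y.re = 0 ∧ (y * star y).re = t₀ ∧
          moebius (rho (-1) 3 (by norm_num) (castQ (-1) 3 y)) τ = τ)} ↦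
            (⟨Quot.mk S ⟨r.1, r.2.1, r.2.2.1⟩, (hiff _ _).2 ((hfix r.1 r.2.1).2 r.2.2.2)⟩ :
              {q : Quot S // Quot.map aW cW q = q}))
          (fun r r' h ↦ Subtype.ext ((hiff _ _).2 h))) ⟨?_, ?_⟩
      · intro x y
        induction x using Quot.ind with
        | _ r =>
          induction y using Quot.ind with
          | _ r' =>
            intro h
            exact Quot.sound ((hiff _ _).1 (congrArg Subtype.val h))
      · rintro ⟨q, hq⟩
        induction q using Quot.ind with
        | _ p =>
          have hfx : S (aW p) p := (hiff _ _).1 hq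
          obtain ⟨v, hv, hv1, h⟩ := hfx
          have h1 := (hfix p.1 p.2.1).1 ⟨v, hv, hv1, h⟩
          exact ⟨Quot.mk _ ⟨p.1, p.2.1, p.2.2, h1⟩, rfl⟩
    rw [hM] at key
    exact key
  · -- `[ρ(W)·]` is an involution: `W² = d·u`, `u ∈ Γ₆`
    intro q
    induction q using Quot.ind with
    | _ p =>
      show Quot.mk S (aW (aW p)) = Quot.mk S p
      rw [hiff]
      refine ⟨star u, star_maxOrder hu, by rw [star_star, star_comm_self' u, hu1], ?_⟩
      show moebius (rho (-1) 3 (by norm_num) (castQ (-1) 3 (star u))) (moebius (rho (-1) 3 (by norm_num) (castQ (-1) 3 W)) (moebius (rho (-1) 3 (by norm_num) (castQ (-1) 3 W)) p.1)) = p.1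
      rw [← moebius_rho_castQ_mul₁₃ hWpos hWpos p.2.1, hsq, moebius_rho_castQ_smul hdpos.ne']
      exact moebius_rho_star_moebius_rho h3' (by rw [hun]; exact one_pos) (UpperHalfPlane.mk p.1 p.2.1)
  · -- onto
    intro q
    induction q using Quot.ind with
    | _ p => exact ⟨Quot.mk S p, rfl⟩
  · -- `P`-invariance under `ρ(W)` (`nr W = d·1²`)
    intro q
    induction q using Quot.ind with
    | _ p =>
      show Quot.mk P (aW p) = Quot.mk P p
      exact ((hiffP p (aW p)).2 ⟨W, hW0, hNW.2.1, hWpos, ⟨1, Or.inr (by rw [hWn]; ring)⟩, rfl⟩).symm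
  · -- fibres `{[p], [ρ(W)p]}`: `Γ₆^{(d)} = ℚ_{>0}·Γ₆·{1, W}`
    intro q₁ q₂
    induction q₁ using Quot.ind with
    | _ p₁ =>
      induction q₂ using Quot.ind with
      | _ p₂ =>
        intro h
        change Quot.mk P p₁ = Quot.mk P p₂ at h
        rw [hiffP] at h
        obtain ⟨g, hg0, hL, hgn, ⟨s, hs⟩, hg⟩ := hEP.symm h
        obtain ⟨q, v, k, l, hq, hv, h1, hk, hl, rfl⟩ := (normalises_maxOrder_iff_exists' hg0).1 hL
        have hWn' := norm_atkinLehner_word₁₃ k l hk hl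
        have hWpos' : 0 < (((⟨1, 1, 0, 0⟩ : ℍ[ℚ,((-1 : ℤ) : ℚ),((3 : ℤ) : ℚ)]) ^ k * ⟨3, 0, 1, 1⟩ ^ l) * star ((⟨1, 1, 0, 0⟩ : ℍ[ℚ,((-1 : ℤ) : ℚ),((3 : ℤ) : ℚ)]) ^ k * ⟨3, 0, 1, 1⟩ ^ l)).re := by
          rw [hWn']; positivity
        have e1 : (q • (v * ⟨1, 1, 0, 0⟩ ^ k * ⟨3, 0, 1, 1⟩ ^ l) *
            star (q • (v * ⟨1, 1, 0, 0⟩ ^ k * ⟨3, 0, 1, 1⟩ ^ l))).re =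
            q ^ 2 * ((v * star v).re * (((⟨1, 1, 0, 0⟩ : ℍ[ℚ,((-1 : ℤ) : ℚ),((3 : ℤ) : ℚ)]) ^ k * ⟨3, 0, 1, 1⟩ ^ l) *
              star ((⟨1, 1, 0, 0⟩ : ℍ[ℚ,((-1 : ℤ) : ℚ),((3 : ℤ) : ℚ)]) ^ k * ⟨3, 0, 1, 1⟩ ^ l)).re) := by
          rw [QuaternionAlgebra.star_smul, smul_mul_assoc, mul_smul_comm, ← mul_smul, QuaternionAlgebra.re_smul,
            smul_eq_mul, mul_assoc v, re_mul_mul_star_mul, pow_two]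
        -- `nr v = 1`
        have hv1 : v * star v = 1 := by
          rcases h1 with h1 | h1
          · exact h1
          · exfalso
            rw [e1, h1, QuaternionAlgebra.re_neg, QuaternionAlgebra.re_one] at hgn
            nlinarith [sq_nonneg q, mul_pos (pow_pos hq 2) hWpos']
        have hvn : (v * star v).re = 1 := by rw [hv1, QuaternionAlgebra.re_one]
        rw [e1, hvn, one_mul, hWn'] at hs
        -- `ρ(g) p₂ = ρ(v)(ρ(w₂^k μ^l) p₂)`
        have hgW : moebius (rho (-1) 3 (by norm_num) (castQ (-1) 3 (q • (v * ⟨1, 1, 0, 0⟩ ^ k * ⟨3, 0, 1, 1⟩ ^ l)))) p₂.1 =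
            moebius (rho (-1) 3 (by norm_num) (castQ (-1) 3 v))
              (moebius (rho (-1) 3 (by norm_num) (castQ (-1) 3 ((⟨1, 1, 0, 0⟩ : ℍ[ℚ,((-1 : ℤ) : ℚ),((3 : ℤ) : ℚ)]) ^ k * ⟨3, 0, 1, 1⟩ ^ l))) p₂.1) := by
          rw [moebius_rho_castQ_smul hq.ne', mul_assoc, moebius_rho_castQ_mul₁₃ hWpos' (by rw [hvn]; exact one_pos) p₂.2.1]
        rw [hgW] at hg
        rcases hexcl k l hk hl q s hq hs with ⟨rfl, rfl⟩ | ⟨rfl, rfl⟩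
        · -- the word is `1`
          left
          rw [hiff]
          refine hE.symm ⟨v, hv, hv1, ?_⟩
          rw [pow_zero, pow_zero, mul_one, moebius_rho_castQ_one₁₃] at hg
          exact hg
        · -- the word is `W`
          right
          show Quot.mk S p₁ = Quot.mk S (aW p₂)
          rw [hiff]
          refine hE.symm ⟨v, hv, hv1, ?_⟩
          rw [← hW] at hg
          exact hg

end Engine

/-! ## §3 The three double covers: `d = 2, 3, 6` -/

section Covers

/-- An integer which is a rational square is a perfect square. [folklore] -/
private theorem exists_eq_sq_of_rat₁₃ {t : ℤ} {c : ℚ} (h : (t : ℚ) = c ^ 2 * 1) : ∃ m : ℤ, t = m ^ 2 := by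
  have hsq : IsSquare ((t : ℤ) : ℚ) := ⟨c, by rw [h, mul_one, sq]⟩
  obtain ⟨m, hm⟩ := Rat.isSquare_intCast_iff.1 hsq
  exact ⟨m, by rw [hm, sq]⟩

/-- An integer `t` with `t = 3c²` (`c ∈ ℚ`) is `3m²`. [folklore] -/
private theorem exists_eq_three_mul_sq_of_rat₁₃ {t : ℤ} {c : ℚ} (h : (t : ℚ) = c ^ 2 * 3) : ∃ m : ℤ, t = 3 * m ^ 2 := by
  have hsq : IsSquare ((3 * t : ℤ) : ℚ) := ⟨3 * c, by push_cast; rw [h]; ring⟩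
  obtain ⟨r, hr⟩ := Rat.isSquare_intCast_iff.1 hsq
  have h3 : (3 : ℤ) ∣ r * r := ⟨t, by rw [← hr]⟩
  obtain ⟨s, rfl⟩ := (Int.prime_three.dvd_mul.1 h3).elim id id
  exact ⟨s, by linarith⟩

/-- An integer `t` with `t = 6c²` (`c ∈ ℚ`) is `6m²`. [folklore] -/
private theorem exists_eq_six_mul_sq_of_rat₁₃ {t : ℤ} {c : ℚ} (h : (t : ℚ) = c ^ 2 * 6) : ∃ m : ℤ, t = 6 * m ^ 2 := by
  have hsq : IsSquare ((6 * t : ℤ) : ℚ) := ⟨6 * c, by push_cast; rw [h]; ring⟩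
  obtain ⟨r, hr⟩ := Rat.isSquare_intCast_iff.1 hsq
  have h2 : (2 : ℤ) ∣ r * r := ⟨3 * t, by rw [← hr]; ring⟩
  obtain ⟨s, rfl⟩ := (Int.prime_two.dvd_mul.1 h2).elim id id
  have h3' : (3 : ℤ) ∣ 2 * (s * s) := ⟨t, by linarith⟩
  have h3 : (3 : ℤ) ∣ s * s := (Int.prime_three.dvd_mul.1 h3').resolve_left (by norm_num)
  obtain ⟨u, rfl⟩ := (Int.prime_three.dvd_mul.1 h3).elim id id
  exact ⟨u, by linarith⟩

/-- **`X₆ → X₆^{(2)}` OVER `Z(t)`, EVERY `t > 0`: `#(Pt(t)/Γ₆) + #((Pt(t) ∩ Pt(1))/Γ₆) = 2·#(Pt(t)/Γ₆^{(2)})`** — `ω₂`'s fixed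
classes under `Z(t)` are the `Z(1)`-points (`w₂² = 2i`; `Γ₆^{(2)} = ℚ_{>0}Γ₆{1, w₂}`). [cite: BayerTravesa2007, §2 p. 318 («`X₆^{(2)} = X₆/⟨ω₂⟩`»)] [cite: Ogg1983RealPoints, §2 p. 284 and (3)] [cite: KudlaRapoportYang2006, §3.4 Remark 3.4.7] -/
theorem card_specialPoints_add_card_inter_eq_two_mul_card_atkinLehnerQuotientTwo {t : ℤ} (ht : 0 < t) :
    Nat.card (Quot (fun p q : {τ : ℂ // 0 < τ.im ∧ ∃ x : ℍ[ℚ,((-1 : ℤ) : ℚ),((3 : ℤ) : ℚ)],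
        x ∈ order (-1) 3 ∧ x.re = 0 ∧ (x * star x).re = t ∧ moebius (rho (-1) 3 (by norm_num) (castQ (-1) 3 x)) τ = τ} ↦
      ∃ v : ℍ[ℚ,((-1 : ℤ) : ℚ),((3 : ℤ) : ℚ)], (v ∈ order (-1) 3 ∨ v - ⟨1/2, 1/2, 1/2, -1/2⟩ ∈ order (-1) 3) ∧
        v * star v = 1 ∧ moebius (rho (-1) 3 (by norm_num) (castQ (-1) 3 v)) p.1 = q.1)) +
    Nat.card (Quot (fun p q : {τ : ℂ // 0 < τ.im ∧ (∃ x : ℍ[ℚ,((-1 : ℤ) : ℚ),((3 : ℤ) : ℚ)],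
        x ∈ order (-1) 3 ∧ x.re = 0 ∧ (x * star x).re = t ∧ moebius (rho (-1) 3 (by norm_num) (castQ (-1) 3 x)) τ = τ) ∧
        (∃ y : ℍ[ℚ,((-1 : ℤ) : ℚ),((3 : ℤ) : ℚ)], y ∈ order (-1) 3 ∧ y.re = 0 ∧ (y * star y).re = ((1 : ℤ) : ℚ) ∧
          moebius (rho (-1) 3 (by norm_num) (castQ (-1) 3 y)) τ = τ)} ↦
      ∃ v : ℍ[ℚ,((-1 : ℤ) : ℚ),((3 : ℤ) : ℚ)], (v ∈ order (-1) 3 ∨ v - ⟨1/2, 1/2, 1/2, -1/2⟩ ∈ order (-1) 3) ∧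
        v * star v = 1 ∧ moebius (rho (-1) 3 (by norm_num) (castQ (-1) 3 v)) p.1 = q.1)) =
    2 * Nat.card (Quot (fun p q : {τ : ℂ // 0 < τ.im ∧ ∃ x : ℍ[ℚ,((-1 : ℤ) : ℚ),((3 : ℤ) : ℚ)],
        x ∈ order (-1) 3 ∧ x.re = 0 ∧ (x * star x).re = t ∧ moebius (rho (-1) 3 (by norm_num) (castQ (-1) 3 x)) τ = τ} ↦
      ∃ g : ℍ[ℚ,((-1 : ℤ) : ℚ),((3 : ℤ) : ℚ)], g ≠ 0 ∧
        (∀ a : ℍ[ℚ,((-1 : ℤ) : ℚ),((3 : ℤ) : ℚ)], (a ∈ order (-1) 3 ∨ a - ⟨1/2, 1/2, 1/2, -1/2⟩ ∈ order (-1) 3) →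
          ∃ b : ℍ[ℚ,((-1 : ℤ) : ℚ),((3 : ℤ) : ℚ)], (b ∈ order (-1) 3 ∨ b - ⟨1/2, 1/2, 1/2, -1/2⟩ ∈ order (-1) 3) ∧
            g * a = b * g) ∧
        0 < (g * star g).re ∧ (∃ s : ℚ, (g * star g).re = s ^ 2 ∨ (g * star g).re = 2 * s ^ 2) ∧
        moebius (rho (-1) 3 (by norm_num) (castQ (-1) 3 g)) p.1 = q.1)) :=
  card_add_inter_eq_two_mul_engine₁₃ ht (d := 2) ⟨1, 1, 0, 0⟩ ⟨0, 1, 0, 0⟩ 1 0 le_rfl zero_le_one (by decide)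
    (by rw [pow_one, pow_zero, mul_one]) (by norm_num) (Or.inl ⟨![0, 1, 0, 0], by ext <;> simp [ofCoords]⟩)
    (by rw [QuaternionAlgebra.star_mk, QuaternionAlgebra.mk_mul_mk]; ext <;> norm_num)
    (by rw [QuaternionAlgebra.mk_mul_mk, QuaternionAlgebra.smul_mk]; ext <;> norm_num)
    (by intro τ hτ; rw [Int.cast_one]; exact normOne_moebius_w2_fixed_iff hτ)
    (by
      intro k l hk hl q s hq hs
      rcases Nat.le_one_iff_eq_zero_or_eq_one.1 hk with rfl | rfl <;>
        rcases Nat.le_one_iff_eq_zero_or_eq_one.1 hl with rfl | rfl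
      · exact Or.inl ⟨rfl, rfl⟩
      · exfalso
        rcases hs with h | h
        · have := isSquare_div_of_mul_sq_eq₁₃ (b := 1) hq.ne' one_ne_zero (by rw [one_mul]; exact h)
          norm_num at this
        · have := isSquare_div_of_mul_sq_eq₁₃ (b := 2) hq.ne' (by norm_num) h
          norm_num at this
      · exact Or.inr ⟨rfl, rfl⟩
      · exfalso
        rcases hs with h | h
        · have := isSquare_div_of_mul_sq_eq₁₃ (b := 1) hq.ne' one_ne_zero (by rw [one_mul]; exact h)
          norm_num at this
        · have := isSquare_div_of_mul_sq_eq₁₃ (b := 2) hq.ne' (by norm_num) h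
          norm_num at this)

/-- **`X₆ → X₆^{(3)}` OVER `Z(t)`, EVERY `t > 0`: `#(Pt(t)/Γ₆) + #((Pt(t) ∩ Pt(3))/Γ₆) = 2·#(Pt(t)/Γ₆^{(3)})`** — `ω₃`'s fixed
classes under `Z(t)` are the `Z(3)`-points (`μ² = 3(5 + 2j + 2ij)`; `Γ₆^{(3)} = ℚ_{>0}Γ₆{1, μ}`). [cite: BayerTravesa2007, §2 p. 318 («`X₆^{(3)} = X₆/⟨ω₃⟩`»)] [cite: Ogg1983RealPoints, §2 p. 284 and (3)] [cite: KudlaRapoportYang2006, §3.4 Remark 3.4.7] -/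
theorem card_specialPoints_add_card_inter_eq_two_mul_card_atkinLehnerQuotientThree {t : ℤ} (ht : 0 < t) :
    Nat.card (Quot (fun p q : {τ : ℂ // 0 < τ.im ∧ ∃ x : ℍ[ℚ,((-1 : ℤ) : ℚ),((3 : ℤ) : ℚ)],
        x ∈ order (-1) 3 ∧ x.re = 0 ∧ (x * star x).re = t ∧ moebius (rho (-1) 3 (by norm_num) (castQ (-1) 3 x)) τ = τ} ↦
      ∃ v : ℍ[ℚ,((-1 : ℤ) : ℚ),((3 : ℤ) : ℚ)], (v ∈ order (-1) 3 ∨ v - ⟨1/2, 1/2, 1/2, -1/2⟩ ∈ order (-1) 3) ∧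
        v * star v = 1 ∧ moebius (rho (-1) 3 (by norm_num) (castQ (-1) 3 v)) p.1 = q.1)) +
    Nat.card (Quot (fun p q : {τ : ℂ // 0 < τ.im ∧ (∃ x : ℍ[ℚ,((-1 : ℤ) : ℚ),((3 : ℤ) : ℚ)],
        x ∈ order (-1) 3 ∧ x.re = 0 ∧ (x * star x).re = t ∧ moebius (rho (-1) 3 (by norm_num) (castQ (-1) 3 x)) τ = τ) ∧
        (∃ y : ℍ[ℚ,((-1 : ℤ) : ℚ),((3 : ℤ) : ℚ)], y ∈ order (-1) 3 ∧ y.re = 0 ∧ (y * star y).re = ((3 : ℤ) : ℚ) ∧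
          moebius (rho (-1) 3 (by norm_num) (castQ (-1) 3 y)) τ = τ)} ↦
      ∃ v : ℍ[ℚ,((-1 : ℤ) : ℚ),((3 : ℤ) : ℚ)], (v ∈ order (-1) 3 ∨ v - ⟨1/2, 1/2, 1/2, -1/2⟩ ∈ order (-1) 3) ∧
        v * star v = 1 ∧ moebius (rho (-1) 3 (by norm_num) (castQ (-1) 3 v)) p.1 = q.1)) =
    2 * Nat.card (Quot (fun p q : {τ : ℂ // 0 < τ.im ∧ ∃ x : ℍ[ℚ,((-1 : ℤ) : ℚ),((3 : ℤ) : ℚ)],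
        x ∈ order (-1) 3 ∧ x.re = 0 ∧ (x * star x).re = t ∧ moebius (rho (-1) 3 (by norm_num) (castQ (-1) 3 x)) τ = τ} ↦
      ∃ g : ℍ[ℚ,((-1 : ℤ) : ℚ),((3 : ℤ) : ℚ)], g ≠ 0 ∧
        (∀ a : ℍ[ℚ,((-1 : ℤ) : ℚ),((3 : ℤ) : ℚ)], (a ∈ order (-1) 3 ∨ a - ⟨1/2, 1/2, 1/2, -1/2⟩ ∈ order (-1) 3) →
          ∃ b : ℍ[ℚ,((-1 : ℤ) : ℚ),((3 : ℤ) : ℚ)], (b ∈ order (-1) 3 ∨ b - ⟨1/2, 1/2, 1/2, -1/2⟩ ∈ order (-1) 3) ∧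
            g * a = b * g) ∧
        0 < (g * star g).re ∧ (∃ s : ℚ, (g * star g).re = s ^ 2 ∨ (g * star g).re = 3 * s ^ 2) ∧
        moebius (rho (-1) 3 (by norm_num) (castQ (-1) 3 g)) p.1 = q.1)) :=
  card_add_inter_eq_two_mul_engine₁₃ ht (d := 3) ⟨3, 0, 1, 1⟩ ⟨5, 0, 2, 2⟩ 0 1 zero_le_one le_rfl (by decide)
    (by rw [pow_zero, pow_one, one_mul]) (by norm_num) (Or.inl ⟨![5, 0, 2, 2], by ext <;> simp [ofCoords]⟩)
    (by rw [QuaternionAlgebra.star_mk, QuaternionAlgebra.mk_mul_mk]; ext <;> norm_num)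
    (by rw [QuaternionAlgebra.mk_mul_mk, QuaternionAlgebra.smul_mk]; ext <;> norm_num)
    (by
      intro τ hτ
      refine (normOne_moebius_mu_fixed_iff hτ).trans ⟨?_, ?_⟩ <;> rintro ⟨y, hy, hre, hn, hf⟩ <;>
        exact ⟨y, hy, hre, by rw [hn]; norm_num, hf⟩)
    (by
      intro k l hk hl q s hq hs
      rcases Nat.le_one_iff_eq_zero_or_eq_one.1 hk with rfl | rfl <;>
        rcases Nat.le_one_iff_eq_zero_or_eq_one.1 hl with rfl | rfl
      · exact Or.inl ⟨rfl, rfl⟩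
      · exact Or.inr ⟨rfl, rfl⟩
      · exfalso
        rcases hs with h | h
        · have := isSquare_div_of_mul_sq_eq₁₃ (b := 1) hq.ne' one_ne_zero (by rw [one_mul]; exact h)
          norm_num at this
        · have := isSquare_div_of_mul_sq_eq₁₃ (b := 3) hq.ne' (by norm_num) h
          norm_num at this
      · exfalso
        rcases hs with h | h
        · have := isSquare_div_of_mul_sq_eq₁₃ (b := 1) hq.ne' one_ne_zero (by rw [one_mul]; exact h)
          norm_num at this
        · have := isSquare_div_of_mul_sq_eq₁₃ (b := 3) hq.ne' (by norm_num) h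
          norm_num at this)

/-- **`X₆ → X₆^{(6)}` OVER `Z(t)`, EVERY `t > 0`: `#(Pt(t)/Γ₆) + #((Pt(t) ∩ Pt(6))/Γ₆) = 2·#(Pt(t)/Γ₆^{(6)})`** — `ω₆`'s fixed
classes under `Z(t)` are the `Z(6)`-points (`w₆ = w₂μ = 3 + 3i + 2ij`, `w₆² = 6(2 + 3i + 2ij)`; `Γ₆^{(6)} = ℚ_{>0}Γ₆{1, w₆}`).
[cite: BayerTravesa2007, §2 p. 318 («`X₆^{(6)} = X₆/⟨ω₆⟩`») and §7 p. 332] [cite: Ogg1983RealPoints, §2 p. 284 and (3)] [cite: KudlaRapoportYang2006, §3.4 Remark 3.4.7] -/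
theorem card_specialPoints_add_card_inter_eq_two_mul_card_atkinLehnerQuotientSix {t : ℤ} (ht : 0 < t) :
    Nat.card (Quot (fun p q : {τ : ℂ // 0 < τ.im ∧ ∃ x : ℍ[ℚ,((-1 : ℤ) : ℚ),((3 : ℤ) : ℚ)],
        x ∈ order (-1) 3 ∧ x.re = 0 ∧ (x * star x).re = t ∧ moebius (rho (-1) 3 (by norm_num) (castQ (-1) 3 x)) τ = τ} ↦
      ∃ v : ℍ[ℚ,((-1 : ℤ) : ℚ),((3 : ℤ) : ℚ)], (v ∈ order (-1) 3 ∨ v - ⟨1/2, 1/2, 1/2, -1/2⟩ ∈ order (-1) 3) ∧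
        v * star v = 1 ∧ moebius (rho (-1) 3 (by norm_num) (castQ (-1) 3 v)) p.1 = q.1)) +
    Nat.card (Quot (fun p q : {τ : ℂ // 0 < τ.im ∧ (∃ x : ℍ[ℚ,((-1 : ℤ) : ℚ),((3 : ℤ) : ℚ)],
        x ∈ order (-1) 3 ∧ x.re = 0 ∧ (x * star x).re = t ∧ moebius (rho (-1) 3 (by norm_num) (castQ (-1) 3 x)) τ = τ) ∧
        (∃ y : ℍ[ℚ,((-1 : ℤ) : ℚ),((3 : ℤ) : ℚ)], y ∈ order (-1) 3 ∧ y.re = 0 ∧ (y * star y).re = ((6 : ℤ) : ℚ) ∧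
          moebius (rho (-1) 3 (by norm_num) (castQ (-1) 3 y)) τ = τ)} ↦
      ∃ v : ℍ[ℚ,((-1 : ℤ) : ℚ),((3 : ℤ) : ℚ)], (v ∈ order (-1) 3 ∨ v - ⟨1/2, 1/2, 1/2, -1/2⟩ ∈ order (-1) 3) ∧
        v * star v = 1 ∧ moebius (rho (-1) 3 (by norm_num) (castQ (-1) 3 v)) p.1 = q.1)) =
    2 * Nat.card (Quot (fun p q : {τ : ℂ // 0 < τ.im ∧ ∃ x : ℍ[ℚ,((-1 : ℤ) : ℚ),((3 : ℤ) : ℚ)],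
        x ∈ order (-1) 3 ∧ x.re = 0 ∧ (x * star x).re = t ∧ moebius (rho (-1) 3 (by norm_num) (castQ (-1) 3 x)) τ = τ} ↦
      ∃ g : ℍ[ℚ,((-1 : ℤ) : ℚ),((3 : ℤ) : ℚ)], g ≠ 0 ∧
        (∀ a : ℍ[ℚ,((-1 : ℤ) : ℚ),((3 : ℤ) : ℚ)], (a ∈ order (-1) 3 ∨ a - ⟨1/2, 1/2, 1/2, -1/2⟩ ∈ order (-1) 3) →
          ∃ b : ℍ[ℚ,((-1 : ℤ) : ℚ),((3 : ℤ) : ℚ)], (b ∈ order (-1) 3 ∨ b - ⟨1/2, 1/2, 1/2, -1/2⟩ ∈ order (-1) 3) ∧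
            g * a = b * g) ∧
        0 < (g * star g).re ∧ (∃ s : ℚ, (g * star g).re = s ^ 2 ∨ (g * star g).re = 6 * s ^ 2) ∧
        moebius (rho (-1) 3 (by norm_num) (castQ (-1) 3 g)) p.1 = q.1)) := by
  have hnm : ((⟨3, 0, 1, 1⟩ : ℍ[ℚ,((-1 : ℤ) : ℚ),((3 : ℤ) : ℚ)]) * star ⟨3, 0, 1, 1⟩).re = 3 := by
    rw [QuaternionAlgebra.star_mk, QuaternionAlgebra.mk_mul_mk]; norm_num
  have hnw : ((⟨1, 1, 0, 0⟩ : ℍ[ℚ,((-1 : ℤ) : ℚ),((3 : ℤ) : ℚ)]) * star ⟨1, 1, 0, 0⟩).re = 2 := by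
    rw [QuaternionAlgebra.star_mk, QuaternionAlgebra.mk_mul_mk]; norm_num
  have hw6 : (⟨1, 1, 0, 0⟩ : ℍ[ℚ,((-1 : ℤ) : ℚ),((3 : ℤ) : ℚ)]) * ⟨3, 0, 1, 1⟩ = ⟨3, 3, 0, 2⟩ := by
    rw [QuaternionAlgebra.mk_mul_mk]; ext <;> norm_num
  refine card_add_inter_eq_two_mul_engine₁₃ ht (d := 6) ⟨3, 3, 0, 2⟩ ⟨2, 3, 0, 2⟩ 1 1 le_rfl le_rfl (by decide)
    (by rw [pow_one, pow_one, hw6]) (by norm_num) (Or.inl ⟨![2, 3, 0, 2], by ext <;> simp [ofCoords]⟩)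
    (by rw [QuaternionAlgebra.star_mk, QuaternionAlgebra.mk_mul_mk]; ext <;> norm_num)
    (by rw [QuaternionAlgebra.mk_mul_mk, QuaternionAlgebra.smul_mk]; ext <;> norm_num)
    (fun τ hτ ↦ ?_) ?_
  · have e := moebius_rho_castQ_mul₁₃ (v := ⟨3, 0, 1, 1⟩) (w := ⟨1, 1, 0, 0⟩) (by rw [hnm]; norm_num) (by rw [hnw]; norm_num) hτ
    rw [hw6] at e
    rw [show ((6 : ℤ) : ℚ) = 6 by norm_num, e]
    exact normOne_moebius_w2_mu_fixed_iff hτ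
  · intro k l hk hl q s hq hs
    rcases Nat.le_one_iff_eq_zero_or_eq_one.1 hk with rfl | rfl <;>
      rcases Nat.le_one_iff_eq_zero_or_eq_one.1 hl with rfl | rfl
    · exact Or.inl ⟨rfl, rfl⟩
    · exfalso
      rcases hs with h | h
      · have := isSquare_div_of_mul_sq_eq₁₃ (b := 1) hq.ne' one_ne_zero (by rw [one_mul]; exact h)
        norm_num at this
      · have := isSquare_div_of_mul_sq_eq₁₃ (b := 6) hq.ne' (by norm_num) h
        norm_num at this
    · exfalso
      rcases hs with h | h
      · have := isSquare_div_of_mul_sq_eq₁₃ (b := 1) hq.ne' one_ne_zero (by rw [one_mul]; exact h)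
        norm_num at this
      · have := isSquare_div_of_mul_sq_eq₁₃ (b := 6) hq.ne' (by norm_num) h
        norm_num at this
    · exact Or.inr ⟨rfl, rfl⟩

end Covers

/-! ## §4 Closed forms: `ω_d` free on `Z(t)` unless `t ∈ ℚ²·t_d` -/

section Closed

/-- **`t` not of the form `m²` (`t > 0`): `#(Pt(t)/Γ₆) = 2·#(Pt(t)/Γ₆^{(2)})`** — `ω₂` acts freely on the points of `Z(t)`
on `X₆`; each point of `X₆^{(2)}` under `Z(t)` has two preimages. [cite: BayerTravesa2007, §2 p. 318] [cite: Ogg1983RealPoints, §2 (3)–(4)] [cite: KudlaRapoportYang2006, §3.4 Remark 3.4.7] -/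
theorem card_specialPoints_eq_two_mul_card_atkinLehnerQuotientTwo_of_not {t : ℤ} (ht : 0 < t)
    (h : ¬ ∃ m : ℤ, t = m ^ 2) :
    Nat.card (Quot (fun p q : {τ : ℂ // 0 < τ.im ∧ ∃ x : ℍ[ℚ,((-1 : ℤ) : ℚ),((3 : ℤ) : ℚ)],
        x ∈ order (-1) 3 ∧ x.re = 0 ∧ (x * star x).re = t ∧ moebius (rho (-1) 3 (by norm_num) (castQ (-1) 3 x)) τ = τ} ↦
      ∃ v : ℍ[ℚ,((-1 : ℤ) : ℚ),((3 : ℤ) : ℚ)], (v ∈ order (-1) 3 ∨ v - ⟨1/2, 1/2, 1/2, -1/2⟩ ∈ order (-1) 3) ∧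
        v * star v = 1 ∧ moebius (rho (-1) 3 (by norm_num) (castQ (-1) 3 v)) p.1 = q.1)) =
    2 * Nat.card (Quot (fun p q : {τ : ℂ // 0 < τ.im ∧ ∃ x : ℍ[ℚ,((-1 : ℤ) : ℚ),((3 : ℤ) : ℚ)],
        x ∈ order (-1) 3 ∧ x.re = 0 ∧ (x * star x).re = t ∧ moebius (rho (-1) 3 (by norm_num) (castQ (-1) 3 x)) τ = τ} ↦
      ∃ g : ℍ[ℚ,((-1 : ℤ) : ℚ),((3 : ℤ) : ℚ)], g ≠ 0 ∧
        (∀ a : ℍ[ℚ,((-1 : ℤ) : ℚ),((3 : ℤ) : ℚ)], (a ∈ order (-1) 3 ∨ a - ⟨1/2, 1/2, 1/2, -1/2⟩ ∈ order (-1) 3) →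
          ∃ b : ℍ[ℚ,((-1 : ℤ) : ℚ),((3 : ℤ) : ℚ)], (b ∈ order (-1) 3 ∨ b - ⟨1/2, 1/2, 1/2, -1/2⟩ ∈ order (-1) 3) ∧
            g * a = b * g) ∧
        0 < (g * star g).re ∧ (∃ s : ℚ, (g * star g).re = s ^ 2 ∨ (g * star g).re = 2 * s ^ 2) ∧
        moebius (rho (-1) 3 (by norm_num) (castQ (-1) 3 g)) p.1 = q.1)) := by
  have key := card_specialPoints_add_card_inter_eq_two_mul_card_atkinLehnerQuotientTwo ht
  have z : ¬ ∃ c : ℚ, (t : ℚ) = c ^ 2 * ((1 : ℤ) : ℚ) := by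
    rintro ⟨c, hc⟩
    rw [Int.cast_one] at hc
    exact h (exists_eq_sq_of_rat₁₃ hc)
  rw [card_specialPoints_inter_eq_zero (by norm_num) z] at key
  omega

/-- **`t = m²` (`t > 0`): `#(Pt(t)/Γ₆) + 2 = 2·#(Pt(t)/Γ₆^{(2)})`** — `ω₂` fixes exactly the two `Z(1)`-points under `Z(t)`.
[cite: BayerTravesa2007, §1 Thm. 1.1, §2 p. 318 and §7] [cite: Ogg1983RealPoints, §2 p. 284 and (3)–(4)] [cite: KudlaRapoportYang2006, §3.4 Remark 3.4.7] -/
theorem card_specialPoints_add_two_eq_two_mul_card_atkinLehnerQuotientTwo_of_sq_mul {t : ℤ} (ht : 0 < t) {m : ℤ}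
    (hm : t = m ^ 2) :
    Nat.card (Quot (fun p q : {τ : ℂ // 0 < τ.im ∧ ∃ x : ℍ[ℚ,((-1 : ℤ) : ℚ),((3 : ℤ) : ℚ)],
        x ∈ order (-1) 3 ∧ x.re = 0 ∧ (x * star x).re = t ∧ moebius (rho (-1) 3 (by norm_num) (castQ (-1) 3 x)) τ = τ} ↦
      ∃ v : ℍ[ℚ,((-1 : ℤ) : ℚ),((3 : ℤ) : ℚ)], (v ∈ order (-1) 3 ∨ v - ⟨1/2, 1/2, 1/2, -1/2⟩ ∈ order (-1) 3) ∧
        v * star v = 1 ∧ moebius (rho (-1) 3 (by norm_num) (castQ (-1) 3 v)) p.1 = q.1)) + 2 =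
    2 * Nat.card (Quot (fun p q : {τ : ℂ // 0 < τ.im ∧ ∃ x : ℍ[ℚ,((-1 : ℤ) : ℚ),((3 : ℤ) : ℚ)],
        x ∈ order (-1) 3 ∧ x.re = 0 ∧ (x * star x).re = t ∧ moebius (rho (-1) 3 (by norm_num) (castQ (-1) 3 x)) τ = τ} ↦
      ∃ g : ℍ[ℚ,((-1 : ℤ) : ℚ),((3 : ℤ) : ℚ)], g ≠ 0 ∧
        (∀ a : ℍ[ℚ,((-1 : ℤ) : ℚ),((3 : ℤ) : ℚ)], (a ∈ order (-1) 3 ∨ a - ⟨1/2, 1/2, 1/2, -1/2⟩ ∈ order (-1) 3) →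
          ∃ b : ℍ[ℚ,((-1 : ℤ) : ℚ),((3 : ℤ) : ℚ)], (b ∈ order (-1) 3 ∨ b - ⟨1/2, 1/2, 1/2, -1/2⟩ ∈ order (-1) 3) ∧
            g * a = b * g) ∧
        0 < (g * star g).re ∧ (∃ s : ℚ, (g * star g).re = s ^ 2 ∨ (g * star g).re = 2 * s ^ 2) ∧
        moebius (rho (-1) 3 (by norm_num) (castQ (-1) 3 g)) p.1 = q.1)) := by
  have key := card_specialPoints_add_card_inter_eq_two_mul_card_atkinLehnerQuotientTwo ht
  have hm0 : m ≠ 0 := by rintro rfl; rw [hm] at ht; norm_num at ht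
  rw [card_specialPoints_inter_eq_card_of_sq_mul (t := t) (t₀ := 1) hm0 (by rw [hm, mul_one]), card_specialPoints_table.1] at key
  omega

/-- **`t` not of the form `3m²` (`t > 0`): `#(Pt(t)/Γ₆) = 2·#(Pt(t)/Γ₆^{(3)})`** — `ω₃` acts freely on the points of `Z(t)`
on `X₆`; each point of `X₆^{(3)}` under `Z(t)` has two preimages. [cite: BayerTravesa2007, §2 p. 318] [cite: Ogg1983RealPoints, §2 (3)–(4)] [cite: KudlaRapoportYang2006, §3.4 Remark 3.4.7] -/
theorem card_specialPoints_eq_two_mul_card_atkinLehnerQuotientThree_of_not {t : ℤ} (ht : 0 < t)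
    (h : ¬ ∃ m : ℤ, t = 3 * m ^ 2) :
    Nat.card (Quot (fun p q : {τ : ℂ // 0 < τ.im ∧ ∃ x : ℍ[ℚ,((-1 : ℤ) : ℚ),((3 : ℤ) : ℚ)],
        x ∈ order (-1) 3 ∧ x.re = 0 ∧ (x * star x).re = t ∧ moebius (rho (-1) 3 (by norm_num) (castQ (-1) 3 x)) τ = τ} ↦
      ∃ v : ℍ[ℚ,((-1 : ℤ) : ℚ),((3 : ℤ) : ℚ)], (v ∈ order (-1) 3 ∨ v - ⟨1/2, 1/2, 1/2, -1/2⟩ ∈ order (-1) 3) ∧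
        v * star v = 1 ∧ moebius (rho (-1) 3 (by norm_num) (castQ (-1) 3 v)) p.1 = q.1)) =
    2 * Nat.card (Quot (fun p q : {τ : ℂ // 0 < τ.im ∧ ∃ x : ℍ[ℚ,((-1 : ℤ) : ℚ),((3 : ℤ) : ℚ)],
        x ∈ order (-1) 3 ∧ x.re = 0 ∧ (x * star x).re = t ∧ moebius (rho (-1) 3 (by norm_num) (castQ (-1) 3 x)) τ = τ} ↦
      ∃ g : ℍ[ℚ,((-1 : ℤ) : ℚ),((3 : ℤ) : ℚ)], g ≠ 0 ∧
        (∀ a : ℍ[ℚ,((-1 : ℤ) : ℚ),((3 : ℤ) : ℚ)], (a ∈ order (-1) 3 ∨ a - ⟨1/2, 1/2, 1/2, -1/2⟩ ∈ order (-1) 3) →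
          ∃ b : ℍ[ℚ,((-1 : ℤ) : ℚ),((3 : ℤ) : ℚ)], (b ∈ order (-1) 3 ∨ b - ⟨1/2, 1/2, 1/2, -1/2⟩ ∈ order (-1) 3) ∧
            g * a = b * g) ∧
        0 < (g * star g).re ∧ (∃ s : ℚ, (g * star g).re = s ^ 2 ∨ (g * star g).re = 3 * s ^ 2) ∧
        moebius (rho (-1) 3 (by norm_num) (castQ (-1) 3 g)) p.1 = q.1)) := by
  have key := card_specialPoints_add_card_inter_eq_two_mul_card_atkinLehnerQuotientThree ht
  have z : ¬ ∃ c : ℚ, (t : ℚ) = c ^ 2 * ((3 : ℤ) : ℚ) := by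
    rintro ⟨c, hc⟩
    rw [show ((3 : ℤ) : ℚ) = 3 by norm_num] at hc
    exact h (exists_eq_three_mul_sq_of_rat₁₃ hc)
  rw [card_specialPoints_inter_eq_zero (by norm_num) z] at key
  omega

/-- **`t = 3m²` (`t > 0`): `#(Pt(t)/Γ₆) + 2 = 2·#(Pt(t)/Γ₆^{(3)})`** — `ω₃` fixes exactly the two `Z(3)`-points under `Z(t)`.
[cite: BayerTravesa2007, §1 Thm. 1.1, §2 p. 318 and §7] [cite: Ogg1983RealPoints, §2 p. 284 and (3)–(4)] [cite: KudlaRapoportYang2006, §3.4 Remark 3.4.7] -/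
theorem card_specialPoints_add_two_eq_two_mul_card_atkinLehnerQuotientThree_of_sq_mul {t : ℤ} (ht : 0 < t) {m : ℤ}
    (hm : t = 3 * m ^ 2) :
    Nat.card (Quot (fun p q : {τ : ℂ // 0 < τ.im ∧ ∃ x : ℍ[ℚ,((-1 : ℤ) : ℚ),((3 : ℤ) : ℚ)],
        x ∈ order (-1) 3 ∧ x.re = 0 ∧ (x * star x).re = t ∧ moebius (rho (-1) 3 (by norm_num) (castQ (-1) 3 x)) τ = τ} ↦
      ∃ v : ℍ[ℚ,((-1 : ℤ) : ℚ),((3 : ℤ) : ℚ)], (v ∈ order (-1) 3 ∨ v - ⟨1/2, 1/2, 1/2, -1/2⟩ ∈ order (-1) 3) ∧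
        v * star v = 1 ∧ moebius (rho (-1) 3 (by norm_num) (castQ (-1) 3 v)) p.1 = q.1)) + 2 =
    2 * Nat.card (Quot (fun p q : {τ : ℂ // 0 < τ.im ∧ ∃ x : ℍ[ℚ,((-1 : ℤ) : ℚ),((3 : ℤ) : ℚ)],
        x ∈ order (-1) 3 ∧ x.re = 0 ∧ (x * star x).re = t ∧ moebius (rho (-1) 3 (by norm_num) (castQ (-1) 3 x)) τ = τ} ↦
      ∃ g : ℍ[ℚ,((-1 : ℤ) : ℚ),((3 : ℤ) : ℚ)], g ≠ 0 ∧
        (∀ a : ℍ[ℚ,((-1 : ℤ) : ℚ),((3 : ℤ) : ℚ)], (a ∈ order (-1) 3 ∨ a - ⟨1/2, 1/2, 1/2, -1/2⟩ ∈ order (-1) 3) →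
          ∃ b : ℍ[ℚ,((-1 : ℤ) : ℚ),((3 : ℤ) : ℚ)], (b ∈ order (-1) 3 ∨ b - ⟨1/2, 1/2, 1/2, -1/2⟩ ∈ order (-1) 3) ∧
            g * a = b * g) ∧
        0 < (g * star g).re ∧ (∃ s : ℚ, (g * star g).re = s ^ 2 ∨ (g * star g).re = 3 * s ^ 2) ∧
        moebius (rho (-1) 3 (by norm_num) (castQ (-1) 3 g)) p.1 = q.1)) := by
  have key := card_specialPoints_add_card_inter_eq_two_mul_card_atkinLehnerQuotientThree ht
  have hm0 : m ≠ 0 := by rintro rfl; rw [hm] at ht; norm_num at ht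
  rw [card_specialPoints_inter_eq_card_of_sq_mul (t := t) (t₀ := 3) hm0 (by rw [hm, mul_comm]), card_specialPoints_table.2.1] at key
  omega

/-- **`t` not of the form `6m²` (`t > 0`): `#(Pt(t)/Γ₆) = 2·#(Pt(t)/Γ₆^{(6)})`** — `ω₆` acts freely on the points of `Z(t)`
on `X₆`; each point of `X₆^{(6)}` under `Z(t)` has two preimages. [cite: BayerTravesa2007, §2 p. 318] [cite: Ogg1983RealPoints, §2 (3)–(4)] [cite: KudlaRapoportYang2006, §3.4 Remark 3.4.7] -/
theorem card_specialPoints_eq_two_mul_card_atkinLehnerQuotientSix_of_not {t : ℤ} (ht : 0 < t)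
    (h : ¬ ∃ m : ℤ, t = 6 * m ^ 2) :
    Nat.card (Quot (fun p q : {τ : ℂ // 0 < τ.im ∧ ∃ x : ℍ[ℚ,((-1 : ℤ) : ℚ),((3 : ℤ) : ℚ)],
        x ∈ order (-1) 3 ∧ x.re = 0 ∧ (x * star x).re = t ∧ moebius (rho (-1) 3 (by norm_num) (castQ (-1) 3 x)) τ = τ} ↦
      ∃ v : ℍ[ℚ,((-1 : ℤ) : ℚ),((3 : ℤ) : ℚ)], (v ∈ order (-1) 3 ∨ v - ⟨1/2, 1/2, 1/2, -1/2⟩ ∈ order (-1) 3) ∧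
        v * star v = 1 ∧ moebius (rho (-1) 3 (by norm_num) (castQ (-1) 3 v)) p.1 = q.1)) =
    2 * Nat.card (Quot (fun p q : {τ : ℂ // 0 < τ.im ∧ ∃ x : ℍ[ℚ,((-1 : ℤ) : ℚ),((3 : ℤ) : ℚ)],
        x ∈ order (-1) 3 ∧ x.re = 0 ∧ (x * star x).re = t ∧ moebius (rho (-1) 3 (by norm_num) (castQ (-1) 3 x)) τ = τ} ↦
      ∃ g : ℍ[ℚ,((-1 : ℤ) : ℚ),((3 : ℤ) : ℚ)], g ≠ 0 ∧
        (∀ a : ℍ[ℚ,((-1 : ℤ) : ℚ),((3 : ℤ) : ℚ)], (a ∈ order (-1) 3 ∨ a - ⟨1/2, 1/2, 1/2, -1/2⟩ ∈ order (-1) 3) →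
          ∃ b : ℍ[ℚ,((-1 : ℤ) : ℚ),((3 : ℤ) : ℚ)], (b ∈ order (-1) 3 ∨ b - ⟨1/2, 1/2, 1/2, -1/2⟩ ∈ order (-1) 3) ∧
            g * a = b * g) ∧
        0 < (g * star g).re ∧ (∃ s : ℚ, (g * star g).re = s ^ 2 ∨ (g * star g).re = 6 * s ^ 2) ∧
        moebius (rho (-1) 3 (by norm_num) (castQ (-1) 3 g)) p.1 = q.1)) := by
  have key := card_specialPoints_add_card_inter_eq_two_mul_card_atkinLehnerQuotientSix ht
  have z : ¬ ∃ c : ℚ, (t : ℚ) = c ^ 2 * ((6 : ℤ) : ℚ) := by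
    rintro ⟨c, hc⟩
    rw [show ((6 : ℤ) : ℚ) = 6 by norm_num] at hc
    exact h (exists_eq_six_mul_sq_of_rat₁₃ hc)
  rw [card_specialPoints_inter_eq_zero (by norm_num) z] at key
  omega

/-- **`t = 6m²` (`t > 0`): `#(Pt(t)/Γ₆) + 2 = 2·#(Pt(t)/Γ₆^{(6)})`** — `ω₆` fixes exactly the two `Z(6)`-points under `Z(t)`.
[cite: BayerTravesa2007, §1 Thm. 1.1, §2 p. 318 and §7] [cite: Ogg1983RealPoints, §2 p. 284 and (3)–(4)] [cite: KudlaRapoportYang2006, §3.4 Remark 3.4.7] -/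
theorem card_specialPoints_add_two_eq_two_mul_card_atkinLehnerQuotientSix_of_sq_mul {t : ℤ} (ht : 0 < t) {m : ℤ}
    (hm : t = 6 * m ^ 2) :
    Nat.card (Quot (fun p q : {τ : ℂ // 0 < τ.im ∧ ∃ x : ℍ[ℚ,((-1 : ℤ) : ℚ),((3 : ℤ) : ℚ)],
        x ∈ order (-1) 3 ∧ x.re = 0 ∧ (x * star x).re = t ∧ moebius (rho (-1) 3 (by norm_num) (castQ (-1) 3 x)) τ = τ} ↦
      ∃ v : ℍ[ℚ,((-1 : ℤ) : ℚ),((3 : ℤ) : ℚ)], (v ∈ order (-1) 3 ∨ v - ⟨1/2, 1/2, 1/2, -1/2⟩ ∈ order (-1) 3) ∧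
        v * star v = 1 ∧ moebius (rho (-1) 3 (by norm_num) (castQ (-1) 3 v)) p.1 = q.1)) + 2 =
    2 * Nat.card (Quot (fun p q : {τ : ℂ // 0 < τ.im ∧ ∃ x : ℍ[ℚ,((-1 : ℤ) : ℚ),((3 : ℤ) : ℚ)],
        x ∈ order (-1) 3 ∧ x.re = 0 ∧ (x * star x).re = t ∧ moebius (rho (-1) 3 (by norm_num) (castQ (-1) 3 x)) τ = τ} ↦
      ∃ g : ℍ[ℚ,((-1 : ℤ) : ℚ),((3 : ℤ) : ℚ)], g ≠ 0 ∧
        (∀ a : ℍ[ℚ,((-1 : ℤ) : ℚ),((3 : ℤ) : ℚ)], (a ∈ order (-1) 3 ∨ a - ⟨1/2, 1/2, 1/2, -1/2⟩ ∈ order (-1) 3) →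
          ∃ b : ℍ[ℚ,((-1 : ℤ) : ℚ),((3 : ℤ) : ℚ)], (b ∈ order (-1) 3 ∨ b - ⟨1/2, 1/2, 1/2, -1/2⟩ ∈ order (-1) 3) ∧
            g * a = b * g) ∧
        0 < (g * star g).re ∧ (∃ s : ℚ, (g * star g).re = s ^ 2 ∨ (g * star g).re = 6 * s ^ 2) ∧
        moebius (rho (-1) 3 (by norm_num) (castQ (-1) 3 g)) p.1 = q.1)) := by
  have key := card_specialPoints_add_card_inter_eq_two_mul_card_atkinLehnerQuotientSix ht
  have hm0 : m ≠ 0 := by rintro rfl; rw [hm] at ht; norm_num at ht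
  rw [card_specialPoints_inter_eq_card_of_sq_mul (t := t) (t₀ := 6) hm0 (by rw [hm, mul_comm]), card_specialPoints_table.2.2.1] at key
  omega

end Closed

/-! ## §5 The ten-value tables -/

section Tables

/-- `¬ IsSquare t ⟹ t ≠ m²`. [folklore] -/
private theorem not_exists_eq_sq₁₃ {t : ℤ} (h : ¬ IsSquare t) : ¬ ∃ m : ℤ, t = m ^ 2 := by
  rintro ⟨m, hm⟩
  exact h ⟨m, by rw [hm, sq]⟩

/-- `k ∤ t ⟹ t ≠ k·m²`. [folklore] -/
private theorem not_exists_eq_mul_sq_of_not_dvd₁₃ {t k : ℤ} (h : ¬ k ∣ t) : ¬ ∃ m : ℤ, t = k * m ^ 2 := by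
  rintro ⟨m, hm⟩
  exact h ⟨m ^ 2, hm⟩

/-- `t = k·r`, `k ≠ 0`, `r` not a square ⟹ `t ≠ k·m²`. [folklore] -/
private theorem not_exists_eq_mul_sq_of_not_isSquare₁₃ {t k r : ℤ} (hk : k ≠ 0) (hr : t = k * r) (hnr : ¬ IsSquare r) :
    ¬ ∃ m : ℤ, t = k * m ^ 2 := by
  rintro ⟨m, hm⟩
  rw [hr] at hm
  exact hnr ⟨m, by rw [mul_left_cancel₀ hk hm, sq]⟩

/-- **THE POINTS OF `Z(t)` ON `X₆^{(2)}` FOR `t = 1, 3, 6, 10, 13, 19, 21, 22, 25, 75`: `2, 1, 1, 2, 2, 2, 2, 2, 4, 3`** (against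
`2, 2, 2, 4, 4, 4, 4, 4, 6, 6` on `X₆` and `1, 1, 1, 1, 1, 1, 1, 1, 2, 2` on `X₆⁺`). [cite: BayerTravesa2007, §2 and §7 Table 9] [cite: Ogg1983RealPoints, §2 (3)–(4)] [cite: KudlaRapoportYang2006, §3.4 (3.4.13) and Remark 3.4.7] -/
theorem card_atkinLehnerQuotientTwo_table :
    Nat.card (Quot (fun p q : {τ : ℂ // 0 < τ.im ∧ ∃ x : ℍ[ℚ,((-1 : ℤ) : ℚ),((3 : ℤ) : ℚ)],
        x ∈ order (-1) 3 ∧ x.re = 0 ∧ (x * star x).re = ((1 : ℤ) : ℚ) ∧ moebius (rho (-1) 3 (by norm_num) (castQ (-1) 3 x)) τ = τ} ↦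
      ∃ g : ℍ[ℚ,((-1 : ℤ) : ℚ),((3 : ℤ) : ℚ)], g ≠ 0 ∧
        (∀ a : ℍ[ℚ,((-1 : ℤ) : ℚ),((3 : ℤ) : ℚ)], (a ∈ order (-1) 3 ∨ a - ⟨1/2, 1/2, 1/2, -1/2⟩ ∈ order (-1) 3) →
          ∃ b : ℍ[ℚ,((-1 : ℤ) : ℚ),((3 : ℤ) : ℚ)], (b ∈ order (-1) 3 ∨ b - ⟨1/2, 1/2, 1/2, -1/2⟩ ∈ order (-1) 3) ∧
            g * a = b * g) ∧
        0 < (g * star g).re ∧ (∃ s : ℚ, (g * star g).re = s ^ 2 ∨ (g * star g).re = 2 * s ^ 2) ∧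
        moebius (rho (-1) 3 (by norm_num) (castQ (-1) 3 g)) p.1 = q.1)) = 2 ∧
    Nat.card (Quot (fun p q : {τ : ℂ // 0 < τ.im ∧ ∃ x : ℍ[ℚ,((-1 : ℤ) : ℚ),((3 : ℤ) : ℚ)],
        x ∈ order (-1) 3 ∧ x.re = 0 ∧ (x * star x).re = ((3 : ℤ) : ℚ) ∧ moebius (rho (-1) 3 (by norm_num) (castQ (-1) 3 x)) τ = τ} ↦
      ∃ g : ℍ[ℚ,((-1 : ℤ) : ℚ),((3 : ℤ) : ℚ)], g ≠ 0 ∧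
        (∀ a : ℍ[ℚ,((-1 : ℤ) : ℚ),((3 : ℤ) : ℚ)], (a ∈ order (-1) 3 ∨ a - ⟨1/2, 1/2, 1/2, -1/2⟩ ∈ order (-1) 3) →
          ∃ b : ℍ[ℚ,((-1 : ℤ) : ℚ),((3 : ℤ) : ℚ)], (b ∈ order (-1) 3 ∨ b - ⟨1/2, 1/2, 1/2, -1/2⟩ ∈ order (-1) 3) ∧
            g * a = b * g) ∧
        0 < (g * star g).re ∧ (∃ s : ℚ, (g * star g).re = s ^ 2 ∨ (g * star g).re = 2 * s ^ 2) ∧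
        moebius (rho (-1) 3 (by norm_num) (castQ (-1) 3 g)) p.1 = q.1)) = 1 ∧
    Nat.card (Quot (fun p q : {τ : ℂ // 0 < τ.im ∧ ∃ x : ℍ[ℚ,((-1 : ℤ) : ℚ),((3 : ℤ) : ℚ)],
        x ∈ order (-1) 3 ∧ x.re = 0 ∧ (x * star x).re = ((6 : ℤ) : ℚ) ∧ moebius (rho (-1) 3 (by norm_num) (castQ (-1) 3 x)) τ = τ} ↦
      ∃ g : ℍ[ℚ,((-1 : ℤ) : ℚ),((3 : ℤ) : ℚ)], g ≠ 0 ∧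
        (∀ a : ℍ[ℚ,((-1 : ℤ) : ℚ),((3 : ℤ) : ℚ)], (a ∈ order (-1) 3 ∨ a - ⟨1/2, 1/2, 1/2, -1/2⟩ ∈ order (-1) 3) →
          ∃ b : ℍ[ℚ,((-1 : ℤ) : ℚ),((3 : ℤ) : ℚ)], (b ∈ order (-1) 3 ∨ b - ⟨1/2, 1/2, 1/2, -1/2⟩ ∈ order (-1) 3) ∧
            g * a = b * g) ∧
        0 < (g * star g).re ∧ (∃ s : ℚ, (g * star g).re = s ^ 2 ∨ (g * star g).re = 2 * s ^ 2) ∧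
        moebius (rho (-1) 3 (by norm_num) (castQ (-1) 3 g)) p.1 = q.1)) = 1 ∧
    Nat.card (Quot (fun p q : {τ : ℂ // 0 < τ.im ∧ ∃ x : ℍ[ℚ,((-1 : ℤ) : ℚ),((3 : ℤ) : ℚ)],
        x ∈ order (-1) 3 ∧ x.re = 0 ∧ (x * star x).re = ((10 : ℤ) : ℚ) ∧ moebius (rho (-1) 3 (by norm_num) (castQ (-1) 3 x)) τ = τ} ↦
      ∃ g : ℍ[ℚ,((-1 : ℤ) : ℚ),((3 : ℤ) : ℚ)], g ≠ 0 ∧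
        (∀ a : ℍ[ℚ,((-1 : ℤ) : ℚ),((3 : ℤ) : ℚ)], (a ∈ order (-1) 3 ∨ a - ⟨1/2, 1/2, 1/2, -1/2⟩ ∈ order (-1) 3) →
          ∃ b : ℍ[ℚ,((-1 : ℤ) : ℚ),((3 : ℤ) : ℚ)], (b ∈ order (-1) 3 ∨ b - ⟨1/2, 1/2, 1/2, -1/2⟩ ∈ order (-1) 3) ∧
            g * a = b * g) ∧
        0 < (g * star g).re ∧ (∃ s : ℚ, (g * star g).re = s ^ 2 ∨ (g * star g).re = 2 * s ^ 2) ∧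
        moebius (rho (-1) 3 (by norm_num) (castQ (-1) 3 g)) p.1 = q.1)) = 2 ∧
    Nat.card (Quot (fun p q : {τ : ℂ // 0 < τ.im ∧ ∃ x : ℍ[ℚ,((-1 : ℤ) : ℚ),((3 : ℤ) : ℚ)],
        x ∈ order (-1) 3 ∧ x.re = 0 ∧ (x * star x).re = ((13 : ℤ) : ℚ) ∧ moebius (rho (-1) 3 (by norm_num) (castQ (-1) 3 x)) τ = τ} ↦
      ∃ g : ℍ[ℚ,((-1 : ℤ) : ℚ),((3 : ℤ) : ℚ)], g ≠ 0 ∧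
        (∀ a : ℍ[ℚ,((-1 : ℤ) : ℚ),((3 : ℤ) : ℚ)], (a ∈ order (-1) 3 ∨ a - ⟨1/2, 1/2, 1/2, -1/2⟩ ∈ order (-1) 3) →
          ∃ b : ℍ[ℚ,((-1 : ℤ) : ℚ),((3 : ℤ) : ℚ)], (b ∈ order (-1) 3 ∨ b - ⟨1/2, 1/2, 1/2, -1/2⟩ ∈ order (-1) 3) ∧
            g * a = b * g) ∧
        0 < (g * star g).re ∧ (∃ s : ℚ, (g * star g).re = s ^ 2 ∨ (g * star g).re = 2 * s ^ 2) ∧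
        moebius (rho (-1) 3 (by norm_num) (castQ (-1) 3 g)) p.1 = q.1)) = 2 ∧
    Nat.card (Quot (fun p q : {τ : ℂ // 0 < τ.im ∧ ∃ x : ℍ[ℚ,((-1 : ℤ) : ℚ),((3 : ℤ) : ℚ)],
        x ∈ order (-1) 3 ∧ x.re = 0 ∧ (x * star x).re = ((19 : ℤ) : ℚ) ∧ moebius (rho (-1) 3 (by norm_num) (castQ (-1) 3 x)) τ = τ} ↦
      ∃ g : ℍ[ℚ,((-1 : ℤ) : ℚ),((3 : ℤ) : ℚ)], g ≠ 0 ∧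
        (∀ a : ℍ[ℚ,((-1 : ℤ) : ℚ),((3 : ℤ) : ℚ)], (a ∈ order (-1) 3 ∨ a - ⟨1/2, 1/2, 1/2, -1/2⟩ ∈ order (-1) 3) →
          ∃ b : ℍ[ℚ,((-1 : ℤ) : ℚ),((3 : ℤ) : ℚ)], (b ∈ order (-1) 3 ∨ b - ⟨1/2, 1/2, 1/2, -1/2⟩ ∈ order (-1) 3) ∧
            g * a = b * g) ∧
        0 < (g * star g).re ∧ (∃ s : ℚ, (g * star g).re = s ^ 2 ∨ (g * star g).re = 2 * s ^ 2) ∧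
        moebius (rho (-1) 3 (by norm_num) (castQ (-1) 3 g)) p.1 = q.1)) = 2 ∧
    Nat.card (Quot (fun p q : {τ : ℂ // 0 < τ.im ∧ ∃ x : ℍ[ℚ,((-1 : ℤ) : ℚ),((3 : ℤ) : ℚ)],
        x ∈ order (-1) 3 ∧ x.re = 0 ∧ (x * star x).re = ((21 : ℤ) : ℚ) ∧ moebius (rho (-1) 3 (by norm_num) (castQ (-1) 3 x)) τ = τ} ↦
      ∃ g : ℍ[ℚ,((-1 : ℤ) : ℚ),((3 : ℤ) : ℚ)], g ≠ 0 ∧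
        (∀ a : ℍ[ℚ,((-1 : ℤ) : ℚ),((3 : ℤ) : ℚ)], (a ∈ order (-1) 3 ∨ a - ⟨1/2, 1/2, 1/2, -1/2⟩ ∈ order (-1) 3) →
          ∃ b : ℍ[ℚ,((-1 : ℤ) : ℚ),((3 : ℤ) : ℚ)], (b ∈ order (-1) 3 ∨ b - ⟨1/2, 1/2, 1/2, -1/2⟩ ∈ order (-1) 3) ∧
            g * a = b * g) ∧
        0 < (g * star g).re ∧ (∃ s : ℚ, (g * star g).re = s ^ 2 ∨ (g * star g).re = 2 * s ^ 2) ∧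
        moebius (rho (-1) 3 (by norm_num) (castQ (-1) 3 g)) p.1 = q.1)) = 2 ∧
    Nat.card (Quot (fun p q : {τ : ℂ // 0 < τ.im ∧ ∃ x : ℍ[ℚ,((-1 : ℤ) : ℚ),((3 : ℤ) : ℚ)],
        x ∈ order (-1) 3 ∧ x.re = 0 ∧ (x * star x).re = ((22 : ℤ) : ℚ) ∧ moebius (rho (-1) 3 (by norm_num) (castQ (-1) 3 x)) τ = τ} ↦
      ∃ g : ℍ[ℚ,((-1 : ℤ) : ℚ),((3 : ℤ) : ℚ)], g ≠ 0 ∧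
        (∀ a : ℍ[ℚ,((-1 : ℤ) : ℚ),((3 : ℤ) : ℚ)], (a ∈ order (-1) 3 ∨ a - ⟨1/2, 1/2, 1/2, -1/2⟩ ∈ order (-1) 3) →
          ∃ b : ℍ[ℚ,((-1 : ℤ) : ℚ),((3 : ℤ) : ℚ)], (b ∈ order (-1) 3 ∨ b - ⟨1/2, 1/2, 1/2, -1/2⟩ ∈ order (-1) 3) ∧
            g * a = b * g) ∧
        0 < (g * star g).re ∧ (∃ s : ℚ, (g * star g).re = s ^ 2 ∨ (g * star g).re = 2 * s ^ 2) ∧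
        moebius (rho (-1) 3 (by norm_num) (castQ (-1) 3 g)) p.1 = q.1)) = 2 ∧
    Nat.card (Quot (fun p q : {τ : ℂ // 0 < τ.im ∧ ∃ x : ℍ[ℚ,((-1 : ℤ) : ℚ),((3 : ℤ) : ℚ)],
        x ∈ order (-1) 3 ∧ x.re = 0 ∧ (x * star x).re = ((25 : ℤ) : ℚ) ∧ moebius (rho (-1) 3 (by norm_num) (castQ (-1) 3 x)) τ = τ} ↦
      ∃ g : ℍ[ℚ,((-1 : ℤ) : ℚ),((3 : ℤ) : ℚ)], g ≠ 0 ∧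
        (∀ a : ℍ[ℚ,((-1 : ℤ) : ℚ),((3 : ℤ) : ℚ)], (a ∈ order (-1) 3 ∨ a - ⟨1/2, 1/2, 1/2, -1/2⟩ ∈ order (-1) 3) →
          ∃ b : ℍ[ℚ,((-1 : ℤ) : ℚ),((3 : ℤ) : ℚ)], (b ∈ order (-1) 3 ∨ b - ⟨1/2, 1/2, 1/2, -1/2⟩ ∈ order (-1) 3) ∧
            g * a = b * g) ∧
        0 < (g * star g).re ∧ (∃ s : ℚ, (g * star g).re = s ^ 2 ∨ (g * star g).re = 2 * s ^ 2) ∧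
        moebius (rho (-1) 3 (by norm_num) (castQ (-1) 3 g)) p.1 = q.1)) = 4 ∧
    Nat.card (Quot (fun p q : {τ : ℂ // 0 < τ.im ∧ ∃ x : ℍ[ℚ,((-1 : ℤ) : ℚ),((3 : ℤ) : ℚ)],
        x ∈ order (-1) 3 ∧ x.re = 0 ∧ (x * star x).re = ((75 : ℤ) : ℚ) ∧ moebius (rho (-1) 3 (by norm_num) (castQ (-1) 3 x)) τ = τ} ↦
      ∃ g : ℍ[ℚ,((-1 : ℤ) : ℚ),((3 : ℤ) : ℚ)], g ≠ 0 ∧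
        (∀ a : ℍ[ℚ,((-1 : ℤ) : ℚ),((3 : ℤ) : ℚ)], (a ∈ order (-1) 3 ∨ a - ⟨1/2, 1/2, 1/2, -1/2⟩ ∈ order (-1) 3) →
          ∃ b : ℍ[ℚ,((-1 : ℤ) : ℚ),((3 : ℤ) : ℚ)], (b ∈ order (-1) 3 ∨ b - ⟨1/2, 1/2, 1/2, -1/2⟩ ∈ order (-1) 3) ∧
            g * a = b * g) ∧
        0 < (g * star g).re ∧ (∃ s : ℚ, (g * star g).re = s ^ 2 ∨ (g * star g).re = 2 * s ^ 2) ∧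
        moebius (rho (-1) 3 (by norm_num) (castQ (-1) 3 g)) p.1 = q.1)) = 3 :=
  ⟨by
      have h := card_specialPoints_add_two_eq_two_mul_card_atkinLehnerQuotientTwo_of_sq_mul (t := 1) (by norm_num) (m := 1) (by norm_num)
      rw [card_specialPoints_table.1] at h; omega,
    by
      have h := card_specialPoints_eq_two_mul_card_atkinLehnerQuotientTwo_of_not (t := 3) (by norm_num)
        (not_exists_eq_sq₁₃ (by norm_num))
      rw [card_specialPoints_table.2.1] at h; omega,
    by
      have h := card_specialPoints_eq_two_mul_card_atkinLehnerQuotientTwo_of_not (t := 6) (by norm_num)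
        (not_exists_eq_sq₁₃ (by norm_num))
      rw [card_specialPoints_table.2.2.1] at h; omega,
    by
      have h := card_specialPoints_eq_two_mul_card_atkinLehnerQuotientTwo_of_not (t := 10) (by norm_num)
        (not_exists_eq_sq₁₃ (by norm_num))
      rw [card_specialPoints_table.2.2.2.1] at h; omega,
    by
      have h := card_specialPoints_eq_two_mul_card_atkinLehnerQuotientTwo_of_not (t := 13) (by norm_num)
        (not_exists_eq_sq₁₃ (by norm_num))
      rw [card_specialPoints_table.2.2.2.2.1] at h; omega,
    by
      have h := card_specialPoints_eq_two_mul_card_atkinLehnerQuotientTwo_of_not (t := 19) (by norm_num)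
        (not_exists_eq_sq₁₃ (by norm_num))
      rw [card_specialPoints_table.2.2.2.2.2.1] at h; omega,
    by
      have h := card_specialPoints_eq_two_mul_card_atkinLehnerQuotientTwo_of_not (t := 21) (by norm_num)
        (not_exists_eq_sq₁₃ (by norm_num))
      rw [card_specialPoints_table.2.2.2.2.2.2.1] at h; omega,
    by
      have h := card_specialPoints_eq_two_mul_card_atkinLehnerQuotientTwo_of_not (t := 22) (by norm_num)
        (not_exists_eq_sq₁₃ (by norm_num))
      rw [card_specialPoints_table.2.2.2.2.2.2.2.1] at h; omega,
    by
      have h := card_specialPoints_add_two_eq_two_mul_card_atkinLehnerQuotientTwo_of_sq_mul (t := 25) (by norm_num) (m := 5) (by norm_num)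
      rw [card_specialPoints_table.2.2.2.2.2.2.2.2.1] at h; omega,
    by
      have h := card_specialPoints_eq_two_mul_card_atkinLehnerQuotientTwo_of_not (t := 75) (by norm_num)
        (not_exists_eq_sq₁₃ (by norm_num))
      rw [card_specialPoints_table.2.2.2.2.2.2.2.2.2] at h; omega⟩

/-- **THE POINTS OF `Z(t)` ON `X₆^{(3)}` FOR `t = 1, 3, 6, 10, 13, 19, 21, 22, 25, 75`: `1, 2, 1, 2, 2, 2, 2, 2, 3, 4`** (against
`2, 2, 2, 4, 4, 4, 4, 4, 6, 6` on `X₆` and `1, 1, 1, 1, 1, 1, 1, 1, 2, 2` on `X₆⁺`). [cite: BayerTravesa2007, §2 and §7 Table 9] [cite: Ogg1983RealPoints, §2 (3)–(4)] [cite: KudlaRapoportYang2006, §3.4 (3.4.13) and Remark 3.4.7] -/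
theorem card_atkinLehnerQuotientThree_table :
    Nat.card (Quot (fun p q : {τ : ℂ // 0 < τ.im ∧ ∃ x : ℍ[ℚ,((-1 : ℤ) : ℚ),((3 : ℤ) : ℚ)],
        x ∈ order (-1) 3 ∧ x.re = 0 ∧ (x * star x).re = ((1 : ℤ) : ℚ) ∧ moebius (rho (-1) 3 (by norm_num) (castQ (-1) 3 x)) τ = τ} ↦
      ∃ g : ℍ[ℚ,((-1 : ℤ) : ℚ),((3 : ℤ) : ℚ)], g ≠ 0 ∧
        (∀ a : ℍ[ℚ,((-1 : ℤ) : ℚ),((3 : ℤ) : ℚ)], (a ∈ order (-1) 3 ∨ a - ⟨1/2, 1/2, 1/2, -1/2⟩ ∈ order (-1) 3) →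
          ∃ b : ℍ[ℚ,((-1 : ℤ) : ℚ),((3 : ℤ) : ℚ)], (b ∈ order (-1) 3 ∨ b - ⟨1/2, 1/2, 1/2, -1/2⟩ ∈ order (-1) 3) ∧
            g * a = b * g) ∧
        0 < (g * star g).re ∧ (∃ s : ℚ, (g * star g).re = s ^ 2 ∨ (g * star g).re = 3 * s ^ 2) ∧
        moebius (rho (-1) 3 (by norm_num) (castQ (-1) 3 g)) p.1 = q.1)) = 1 ∧
    Nat.card (Quot (fun p q : {τ : ℂ // 0 < τ.im ∧ ∃ x : ℍ[ℚ,((-1 : ℤ) : ℚ),((3 : ℤ) : ℚ)],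
        x ∈ order (-1) 3 ∧ x.re = 0 ∧ (x * star x).re = ((3 : ℤ) : ℚ) ∧ moebius (rho (-1) 3 (by norm_num) (castQ (-1) 3 x)) τ = τ} ↦
      ∃ g : ℍ[ℚ,((-1 : ℤ) : ℚ),((3 : ℤ) : ℚ)], g ≠ 0 ∧
        (∀ a : ℍ[ℚ,((-1 : ℤ) : ℚ),((3 : ℤ) : ℚ)], (a ∈ order (-1) 3 ∨ a - ⟨1/2, 1/2, 1/2, -1/2⟩ ∈ order (-1) 3) →
          ∃ b : ℍ[ℚ,((-1 : ℤ) : ℚ),((3 : ℤ) : ℚ)], (b ∈ order (-1) 3 ∨ b - ⟨1/2, 1/2, 1/2, -1/2⟩ ∈ order (-1) 3) ∧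
            g * a = b * g) ∧
        0 < (g * star g).re ∧ (∃ s : ℚ, (g * star g).re = s ^ 2 ∨ (g * star g).re = 3 * s ^ 2) ∧
        moebius (rho (-1) 3 (by norm_num) (castQ (-1) 3 g)) p.1 = q.1)) = 2 ∧
    Nat.card (Quot (fun p q : {τ : ℂ // 0 < τ.im ∧ ∃ x : ℍ[ℚ,((-1 : ℤ) : ℚ),((3 : ℤ) : ℚ)],
        x ∈ order (-1) 3 ∧ x.re = 0 ∧ (x * star x).re = ((6 : ℤ) : ℚ) ∧ moebius (rho (-1) 3 (by norm_num) (castQ (-1) 3 x)) τ = τ} ↦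
      ∃ g : ℍ[ℚ,((-1 : ℤ) : ℚ),((3 : ℤ) : ℚ)], g ≠ 0 ∧
        (∀ a : ℍ[ℚ,((-1 : ℤ) : ℚ),((3 : ℤ) : ℚ)], (a ∈ order (-1) 3 ∨ a - ⟨1/2, 1/2, 1/2, -1/2⟩ ∈ order (-1) 3) →
          ∃ b : ℍ[ℚ,((-1 : ℤ) : ℚ),((3 : ℤ) : ℚ)], (b ∈ order (-1) 3 ∨ b - ⟨1/2, 1/2, 1/2, -1/2⟩ ∈ order (-1) 3) ∧
            g * a = b * g) ∧
        0 < (g * star g).re ∧ (∃ s : ℚ, (g * star g).re = s ^ 2 ∨ (g * star g).re = 3 * s ^ 2) ∧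
        moebius (rho (-1) 3 (by norm_num) (castQ (-1) 3 g)) p.1 = q.1)) = 1 ∧
    Nat.card (Quot (fun p q : {τ : ℂ // 0 < τ.im ∧ ∃ x : ℍ[ℚ,((-1 : ℤ) : ℚ),((3 : ℤ) : ℚ)],
        x ∈ order (-1) 3 ∧ x.re = 0 ∧ (x * star x).re = ((10 : ℤ) : ℚ) ∧ moebius (rho (-1) 3 (by norm_num) (castQ (-1) 3 x)) τ = τ} ↦
      ∃ g : ℍ[ℚ,((-1 : ℤ) : ℚ),((3 : ℤ) : ℚ)], g ≠ 0 ∧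
        (∀ a : ℍ[ℚ,((-1 : ℤ) : ℚ),((3 : ℤ) : ℚ)], (a ∈ order (-1) 3 ∨ a - ⟨1/2, 1/2, 1/2, -1/2⟩ ∈ order (-1) 3) →
          ∃ b : ℍ[ℚ,((-1 : ℤ) : ℚ),((3 : ℤ) : ℚ)], (b ∈ order (-1) 3 ∨ b - ⟨1/2, 1/2, 1/2, -1/2⟩ ∈ order (-1) 3) ∧
            g * a = b * g) ∧
        0 < (g * star g).re ∧ (∃ s : ℚ, (g * star g).re = s ^ 2 ∨ (g * star g).re = 3 * s ^ 2) ∧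
        moebius (rho (-1) 3 (by norm_num) (castQ (-1) 3 g)) p.1 = q.1)) = 2 ∧
    Nat.card (Quot (fun p q : {τ : ℂ // 0 < τ.im ∧ ∃ x : ℍ[ℚ,((-1 : ℤ) : ℚ),((3 : ℤ) : ℚ)],
        x ∈ order (-1) 3 ∧ x.re = 0 ∧ (x * star x).re = ((13 : ℤ) : ℚ) ∧ moebius (rho (-1) 3 (by norm_num) (castQ (-1) 3 x)) τ = τ} ↦
      ∃ g : ℍ[ℚ,((-1 : ℤ) : ℚ),((3 : ℤ) : ℚ)], g ≠ 0 ∧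
        (∀ a : ℍ[ℚ,((-1 : ℤ) : ℚ),((3 : ℤ) : ℚ)], (a ∈ order (-1) 3 ∨ a - ⟨1/2, 1/2, 1/2, -1/2⟩ ∈ order (-1) 3) →
          ∃ b : ℍ[ℚ,((-1 : ℤ) : ℚ),((3 : ℤ) : ℚ)], (b ∈ order (-1) 3 ∨ b - ⟨1/2, 1/2, 1/2, -1/2⟩ ∈ order (-1) 3) ∧
            g * a = b * g) ∧
        0 < (g * star g).re ∧ (∃ s : ℚ, (g * star g).re = s ^ 2 ∨ (g * star g).re = 3 * s ^ 2) ∧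
        moebius (rho (-1) 3 (by norm_num) (castQ (-1) 3 g)) p.1 = q.1)) = 2 ∧
    Nat.card (Quot (fun p q : {τ : ℂ // 0 < τ.im ∧ ∃ x : ℍ[ℚ,((-1 : ℤ) : ℚ),((3 : ℤ) : ℚ)],
        x ∈ order (-1) 3 ∧ x.re = 0 ∧ (x * star x).re = ((19 : ℤ) : ℚ) ∧ moebius (rho (-1) 3 (by norm_num) (castQ (-1) 3 x)) τ = τ} ↦
      ∃ g : ℍ[ℚ,((-1 : ℤ) : ℚ),((3 : ℤ) : ℚ)], g ≠ 0 ∧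
        (∀ a : ℍ[ℚ,((-1 : ℤ) : ℚ),((3 : ℤ) : ℚ)], (a ∈ order (-1) 3 ∨ a - ⟨1/2, 1/2, 1/2, -1/2⟩ ∈ order (-1) 3) →
          ∃ b : ℍ[ℚ,((-1 : ℤ) : ℚ),((3 : ℤ) : ℚ)], (b ∈ order (-1) 3 ∨ b - ⟨1/2, 1/2, 1/2, -1/2⟩ ∈ order (-1) 3) ∧
            g * a = b * g) ∧
        0 < (g * star g).re ∧ (∃ s : ℚ, (g * star g).re = s ^ 2 ∨ (g * star g).re = 3 * s ^ 2) ∧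
        moebius (rho (-1) 3 (by norm_num) (castQ (-1) 3 g)) p.1 = q.1)) = 2 ∧
    Nat.card (Quot (fun p q : {τ : ℂ // 0 < τ.im ∧ ∃ x : ℍ[ℚ,((-1 : ℤ) : ℚ),((3 : ℤ) : ℚ)],
        x ∈ order (-1) 3 ∧ x.re = 0 ∧ (x * star x).re = ((21 : ℤ) : ℚ) ∧ moebius (rho (-1) 3 (by norm_num) (castQ (-1) 3 x)) τ = τ} ↦
      ∃ g : ℍ[ℚ,((-1 : ℤ) : ℚ),((3 : ℤ) : ℚ)], g ≠ 0 ∧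
        (∀ a : ℍ[ℚ,((-1 : ℤ) : ℚ),((3 : ℤ) : ℚ)], (a ∈ order (-1) 3 ∨ a - ⟨1/2, 1/2, 1/2, -1/2⟩ ∈ order (-1) 3) →
          ∃ b : ℍ[ℚ,((-1 : ℤ) : ℚ),((3 : ℤ) : ℚ)], (b ∈ order (-1) 3 ∨ b - ⟨1/2, 1/2, 1/2, -1/2⟩ ∈ order (-1) 3) ∧
            g * a = b * g) ∧
        0 < (g * star g).re ∧ (∃ s : ℚ, (g * star g).re = s ^ 2 ∨ (g * star g).re = 3 * s ^ 2) ∧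
        moebius (rho (-1) 3 (by norm_num) (castQ (-1) 3 g)) p.1 = q.1)) = 2 ∧
    Nat.card (Quot (fun p q : {τ : ℂ // 0 < τ.im ∧ ∃ x : ℍ[ℚ,((-1 : ℤ) : ℚ),((3 : ℤ) : ℚ)],
        x ∈ order (-1) 3 ∧ x.re = 0 ∧ (x * star x).re = ((22 : ℤ) : ℚ) ∧ moebius (rho (-1) 3 (by norm_num) (castQ (-1) 3 x)) τ = τ} ↦
      ∃ g : ℍ[ℚ,((-1 : ℤ) : ℚ),((3 : ℤ) : ℚ)], g ≠ 0 ∧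
        (∀ a : ℍ[ℚ,((-1 : ℤ) : ℚ),((3 : ℤ) : ℚ)], (a ∈ order (-1) 3 ∨ a - ⟨1/2, 1/2, 1/2, -1/2⟩ ∈ order (-1) 3) →
          ∃ b : ℍ[ℚ,((-1 : ℤ) : ℚ),((3 : ℤ) : ℚ)], (b ∈ order (-1) 3 ∨ b - ⟨1/2, 1/2, 1/2, -1/2⟩ ∈ order (-1) 3) ∧
            g * a = b * g) ∧
        0 < (g * star g).re ∧ (∃ s : ℚ, (g * star g).re = s ^ 2 ∨ (g * star g).re = 3 * s ^ 2) ∧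
        moebius (rho (-1) 3 (by norm_num) (castQ (-1) 3 g)) p.1 = q.1)) = 2 ∧
    Nat.card (Quot (fun p q : {τ : ℂ // 0 < τ.im ∧ ∃ x : ℍ[ℚ,((-1 : ℤ) : ℚ),((3 : ℤ) : ℚ)],
        x ∈ order (-1) 3 ∧ x.re = 0 ∧ (x * star x).re = ((25 : ℤ) : ℚ) ∧ moebius (rho (-1) 3 (by norm_num) (castQ (-1) 3 x)) τ = τ} ↦
      ∃ g : ℍ[ℚ,((-1 : ℤ) : ℚ),((3 : ℤ) : ℚ)], g ≠ 0 ∧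
        (∀ a : ℍ[ℚ,((-1 : ℤ) : ℚ),((3 : ℤ) : ℚ)], (a ∈ order (-1) 3 ∨ a - ⟨1/2, 1/2, 1/2, -1/2⟩ ∈ order (-1) 3) →
          ∃ b : ℍ[ℚ,((-1 : ℤ) : ℚ),((3 : ℤ) : ℚ)], (b ∈ order (-1) 3 ∨ b - ⟨1/2, 1/2, 1/2, -1/2⟩ ∈ order (-1) 3) ∧
            g * a = b * g) ∧
        0 < (g * star g).re ∧ (∃ s : ℚ, (g * star g).re = s ^ 2 ∨ (g * star g).re = 3 * s ^ 2) ∧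
        moebius (rho (-1) 3 (by norm_num) (castQ (-1) 3 g)) p.1 = q.1)) = 3 ∧
    Nat.card (Quot (fun p q : {τ : ℂ // 0 < τ.im ∧ ∃ x : ℍ[ℚ,((-1 : ℤ) : ℚ),((3 : ℤ) : ℚ)],
        x ∈ order (-1) 3 ∧ x.re = 0 ∧ (x * star x).re = ((75 : ℤ) : ℚ) ∧ moebius (rho (-1) 3 (by norm_num) (castQ (-1) 3 x)) τ = τ} ↦
      ∃ g : ℍ[ℚ,((-1 : ℤ) : ℚ),((3 : ℤ) : ℚ)], g ≠ 0 ∧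
        (∀ a : ℍ[ℚ,((-1 : ℤ) : ℚ),((3 : ℤ) : ℚ)], (a ∈ order (-1) 3 ∨ a - ⟨1/2, 1/2, 1/2, -1/2⟩ ∈ order (-1) 3) →
          ∃ b : ℍ[ℚ,((-1 : ℤ) : ℚ),((3 : ℤ) : ℚ)], (b ∈ order (-1) 3 ∨ b - ⟨1/2, 1/2, 1/2, -1/2⟩ ∈ order (-1) 3) ∧
            g * a = b * g) ∧
        0 < (g * star g).re ∧ (∃ s : ℚ, (g * star g).re = s ^ 2 ∨ (g * star g).re = 3 * s ^ 2) ∧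
        moebius (rho (-1) 3 (by norm_num) (castQ (-1) 3 g)) p.1 = q.1)) = 4 :=
  ⟨by
      have h := card_specialPoints_eq_two_mul_card_atkinLehnerQuotientThree_of_not (t := 1) (by norm_num)
        (not_exists_eq_mul_sq_of_not_dvd₁₃ (by norm_num))
      rw [card_specialPoints_table.1] at h; omega,
    by
      have h := card_specialPoints_add_two_eq_two_mul_card_atkinLehnerQuotientThree_of_sq_mul (t := 3) (by norm_num) (m := 1) (by norm_num)
      rw [card_specialPoints_table.2.1] at h; omega,
    by
      have h := card_specialPoints_eq_two_mul_card_atkinLehnerQuotientThree_of_not (t := 6) (by norm_num)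
        (not_exists_eq_mul_sq_of_not_isSquare₁₃ (k := 3) (r := 2) (by norm_num) (by norm_num) (by norm_num))
      rw [card_specialPoints_table.2.2.1] at h; omega,
    by
      have h := card_specialPoints_eq_two_mul_card_atkinLehnerQuotientThree_of_not (t := 10) (by norm_num)
        (not_exists_eq_mul_sq_of_not_dvd₁₃ (by norm_num))
      rw [card_specialPoints_table.2.2.2.1] at h; omega,
    by
      have h := card_specialPoints_eq_two_mul_card_atkinLehnerQuotientThree_of_not (t := 13) (by norm_num)
        (not_exists_eq_mul_sq_of_not_dvd₁₃ (by norm_num))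
      rw [card_specialPoints_table.2.2.2.2.1] at h; omega,
    by
      have h := card_specialPoints_eq_two_mul_card_atkinLehnerQuotientThree_of_not (t := 19) (by norm_num)
        (not_exists_eq_mul_sq_of_not_dvd₁₃ (by norm_num))
      rw [card_specialPoints_table.2.2.2.2.2.1] at h; omega,
    by
      have h := card_specialPoints_eq_two_mul_card_atkinLehnerQuotientThree_of_not (t := 21) (by norm_num)
        (not_exists_eq_mul_sq_of_not_isSquare₁₃ (k := 3) (r := 7) (by norm_num) (by norm_num) (by norm_num))
      rw [card_specialPoints_table.2.2.2.2.2.2.1] at h; omega,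
    by
      have h := card_specialPoints_eq_two_mul_card_atkinLehnerQuotientThree_of_not (t := 22) (by norm_num)
        (not_exists_eq_mul_sq_of_not_dvd₁₃ (by norm_num))
      rw [card_specialPoints_table.2.2.2.2.2.2.2.1] at h; omega,
    by
      have h := card_specialPoints_eq_two_mul_card_atkinLehnerQuotientThree_of_not (t := 25) (by norm_num)
        (not_exists_eq_mul_sq_of_not_dvd₁₃ (by norm_num))
      rw [card_specialPoints_table.2.2.2.2.2.2.2.2.1] at h; omega,
    by
      have h := card_specialPoints_add_two_eq_two_mul_card_atkinLehnerQuotientThree_of_sq_mul (t := 75) (by norm_num) (m := 5) (by norm_num)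
      rw [card_specialPoints_table.2.2.2.2.2.2.2.2.2] at h; omega⟩

/-- **THE POINTS OF `Z(t)` ON `X₆^{(6)}` FOR `t = 1, 3, 6, 10, 13, 19, 21, 22, 25, 75`: `1, 1, 2, 2, 2, 2, 2, 2, 3, 3`** (against
`2, 2, 2, 4, 4, 4, 4, 4, 6, 6` on `X₆` and `1, 1, 1, 1, 1, 1, 1, 1, 2, 2` on `X₆⁺`). [cite: BayerTravesa2007, §2 and §7 Table 9] [cite: Ogg1983RealPoints, §2 (3)–(4)] [cite: KudlaRapoportYang2006, §3.4 (3.4.13) and Remark 3.4.7] -/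
theorem card_atkinLehnerQuotientSix_table :
    Nat.card (Quot (fun p q : {τ : ℂ // 0 < τ.im ∧ ∃ x : ℍ[ℚ,((-1 : ℤ) : ℚ),((3 : ℤ) : ℚ)],
        x ∈ order (-1) 3 ∧ x.re = 0 ∧ (x * star x).re = ((1 : ℤ) : ℚ) ∧ moebius (rho (-1) 3 (by norm_num) (castQ (-1) 3 x)) τ = τ} ↦
      ∃ g : ℍ[ℚ,((-1 : ℤ) : ℚ),((3 : ℤ) : ℚ)], g ≠ 0 ∧
        (∀ a : ℍ[ℚ,((-1 : ℤ) : ℚ),((3 : ℤ) : ℚ)], (a ∈ order (-1) 3 ∨ a - ⟨1/2, 1/2, 1/2, -1/2⟩ ∈ order (-1) 3) →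
          ∃ b : ℍ[ℚ,((-1 : ℤ) : ℚ),((3 : ℤ) : ℚ)], (b ∈ order (-1) 3 ∨ b - ⟨1/2, 1/2, 1/2, -1/2⟩ ∈ order (-1) 3) ∧
            g * a = b * g) ∧
        0 < (g * star g).re ∧ (∃ s : ℚ, (g * star g).re = s ^ 2 ∨ (g * star g).re = 6 * s ^ 2) ∧
        moebius (rho (-1) 3 (by norm_num) (castQ (-1) 3 g)) p.1 = q.1)) = 1 ∧
    Nat.card (Quot (fun p q : {τ : ℂ // 0 < τ.im ∧ ∃ x : ℍ[ℚ,((-1 : ℤ) : ℚ),((3 : ℤ) : ℚ)],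
        x ∈ order (-1) 3 ∧ x.re = 0 ∧ (x * star x).re = ((3 : ℤ) : ℚ) ∧ moebius (rho (-1) 3 (by norm_num) (castQ (-1) 3 x)) τ = τ} ↦
      ∃ g : ℍ[ℚ,((-1 : ℤ) : ℚ),((3 : ℤ) : ℚ)], g ≠ 0 ∧
        (∀ a : ℍ[ℚ,((-1 : ℤ) : ℚ),((3 : ℤ) : ℚ)], (a ∈ order (-1) 3 ∨ a - ⟨1/2, 1/2, 1/2, -1/2⟩ ∈ order (-1) 3) →
          ∃ b : ℍ[ℚ,((-1 : ℤ) : ℚ),((3 : ℤ) : ℚ)], (b ∈ order (-1) 3 ∨ b - ⟨1/2, 1/2, 1/2, -1/2⟩ ∈ order (-1) 3) ∧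
            g * a = b * g) ∧
        0 < (g * star g).re ∧ (∃ s : ℚ, (g * star g).re = s ^ 2 ∨ (g * star g).re = 6 * s ^ 2) ∧
        moebius (rho (-1) 3 (by norm_num) (castQ (-1) 3 g)) p.1 = q.1)) = 1 ∧
    Nat.card (Quot (fun p q : {τ : ℂ // 0 < τ.im ∧ ∃ x : ℍ[ℚ,((-1 : ℤ) : ℚ),((3 : ℤ) : ℚ)],
        x ∈ order (-1) 3 ∧ x.re = 0 ∧ (x * star x).re = ((6 : ℤ) : ℚ) ∧ moebius (rho (-1) 3 (by norm_num) (castQ (-1) 3 x)) τ = τ} ↦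
      ∃ g : ℍ[ℚ,((-1 : ℤ) : ℚ),((3 : ℤ) : ℚ)], g ≠ 0 ∧
        (∀ a : ℍ[ℚ,((-1 : ℤ) : ℚ),((3 : ℤ) : ℚ)], (a ∈ order (-1) 3 ∨ a - ⟨1/2, 1/2, 1/2, -1/2⟩ ∈ order (-1) 3) →
          ∃ b : ℍ[ℚ,((-1 : ℤ) : ℚ),((3 : ℤ) : ℚ)], (b ∈ order (-1) 3 ∨ b - ⟨1/2, 1/2, 1/2, -1/2⟩ ∈ order (-1) 3) ∧
            g * a = b * g) ∧
        0 < (g * star g).re ∧ (∃ s : ℚ, (g * star g).re = s ^ 2 ∨ (g * star g).re = 6 * s ^ 2) ∧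
        moebius (rho (-1) 3 (by norm_num) (castQ (-1) 3 g)) p.1 = q.1)) = 2 ∧
    Nat.card (Quot (fun p q : {τ : ℂ // 0 < τ.im ∧ ∃ x : ℍ[ℚ,((-1 : ℤ) : ℚ),((3 : ℤ) : ℚ)],
        x ∈ order (-1) 3 ∧ x.re = 0 ∧ (x * star x).re = ((10 : ℤ) : ℚ) ∧ moebius (rho (-1) 3 (by norm_num) (castQ (-1) 3 x)) τ = τ} ↦
      ∃ g : ℍ[ℚ,((-1 : ℤ) : ℚ),((3 : ℤ) : ℚ)], g ≠ 0 ∧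
        (∀ a : ℍ[ℚ,((-1 : ℤ) : ℚ),((3 : ℤ) : ℚ)], (a ∈ order (-1) 3 ∨ a - ⟨1/2, 1/2, 1/2, -1/2⟩ ∈ order (-1) 3) →
          ∃ b : ℍ[ℚ,((-1 : ℤ) : ℚ),((3 : ℤ) : ℚ)], (b ∈ order (-1) 3 ∨ b - ⟨1/2, 1/2, 1/2, -1/2⟩ ∈ order (-1) 3) ∧
            g * a = b * g) ∧
        0 < (g * star g).re ∧ (∃ s : ℚ, (g * star g).re = s ^ 2 ∨ (g * star g).re = 6 * s ^ 2) ∧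
        moebius (rho (-1) 3 (by norm_num) (castQ (-1) 3 g)) p.1 = q.1)) = 2 ∧
    Nat.card (Quot (fun p q : {τ : ℂ // 0 < τ.im ∧ ∃ x : ℍ[ℚ,((-1 : ℤ) : ℚ),((3 : ℤ) : ℚ)],
        x ∈ order (-1) 3 ∧ x.re = 0 ∧ (x * star x).re = ((13 : ℤ) : ℚ) ∧ moebius (rho (-1) 3 (by norm_num) (castQ (-1) 3 x)) τ = τ} ↦
      ∃ g : ℍ[ℚ,((-1 : ℤ) : ℚ),((3 : ℤ) : ℚ)], g ≠ 0 ∧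
        (∀ a : ℍ[ℚ,((-1 : ℤ) : ℚ),((3 : ℤ) : ℚ)], (a ∈ order (-1) 3 ∨ a - ⟨1/2, 1/2, 1/2, -1/2⟩ ∈ order (-1) 3) →
          ∃ b : ℍ[ℚ,((-1 : ℤ) : ℚ),((3 : ℤ) : ℚ)], (b ∈ order (-1) 3 ∨ b - ⟨1/2, 1/2, 1/2, -1/2⟩ ∈ order (-1) 3) ∧
            g * a = b * g) ∧
        0 < (g * star g).re ∧ (∃ s : ℚ, (g * star g).re = s ^ 2 ∨ (g * star g).re = 6 * s ^ 2) ∧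
        moebius (rho (-1) 3 (by norm_num) (castQ (-1) 3 g)) p.1 = q.1)) = 2 ∧
    Nat.card (Quot (fun p q : {τ : ℂ // 0 < τ.im ∧ ∃ x : ℍ[ℚ,((-1 : ℤ) : ℚ),((3 : ℤ) : ℚ)],
        x ∈ order (-1) 3 ∧ x.re = 0 ∧ (x * star x).re = ((19 : ℤ) : ℚ) ∧ moebius (rho (-1) 3 (by norm_num) (castQ (-1) 3 x)) τ = τ} ↦
      ∃ g : ℍ[ℚ,((-1 : ℤ) : ℚ),((3 : ℤ) : ℚ)], g ≠ 0 ∧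
        (∀ a : ℍ[ℚ,((-1 : ℤ) : ℚ),((3 : ℤ) : ℚ)], (a ∈ order (-1) 3 ∨ a - ⟨1/2, 1/2, 1/2, -1/2⟩ ∈ order (-1) 3) →
          ∃ b : ℍ[ℚ,((-1 : ℤ) : ℚ),((3 : ℤ) : ℚ)], (b ∈ order (-1) 3 ∨ b - ⟨1/2, 1/2, 1/2, -1/2⟩ ∈ order (-1) 3) ∧
            g * a = b * g) ∧
        0 < (g * star g).re ∧ (∃ s : ℚ, (g * star g).re = s ^ 2 ∨ (g * star g).re = 6 * s ^ 2) ∧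
        moebius (rho (-1) 3 (by norm_num) (castQ (-1) 3 g)) p.1 = q.1)) = 2 ∧
    Nat.card (Quot (fun p q : {τ : ℂ // 0 < τ.im ∧ ∃ x : ℍ[ℚ,((-1 : ℤ) : ℚ),((3 : ℤ) : ℚ)],
        x ∈ order (-1) 3 ∧ x.re = 0 ∧ (x * star x).re = ((21 : ℤ) : ℚ) ∧ moebius (rho (-1) 3 (by norm_num) (castQ (-1) 3 x)) τ = τ} ↦
      ∃ g : ℍ[ℚ,((-1 : ℤ) : ℚ),((3 : ℤ) : ℚ)], g ≠ 0 ∧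
        (∀ a : ℍ[ℚ,((-1 : ℤ) : ℚ),((3 : ℤ) : ℚ)], (a ∈ order (-1) 3 ∨ a - ⟨1/2, 1/2, 1/2, -1/2⟩ ∈ order (-1) 3) →
          ∃ b : ℍ[ℚ,((-1 : ℤ) : ℚ),((3 : ℤ) : ℚ)], (b ∈ order (-1) 3 ∨ b - ⟨1/2, 1/2, 1/2, -1/2⟩ ∈ order (-1) 3) ∧
            g * a = b * g) ∧
        0 < (g * star g).re ∧ (∃ s : ℚ, (g * star g).re = s ^ 2 ∨ (g * star g).re = 6 * s ^ 2) ∧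
        moebius (rho (-1) 3 (by norm_num) (castQ (-1) 3 g)) p.1 = q.1)) = 2 ∧
    Nat.card (Quot (fun p q : {τ : ℂ // 0 < τ.im ∧ ∃ x : ℍ[ℚ,((-1 : ℤ) : ℚ),((3 : ℤ) : ℚ)],
        x ∈ order (-1) 3 ∧ x.re = 0 ∧ (x * star x).re = ((22 : ℤ) : ℚ) ∧ moebius (rho (-1) 3 (by norm_num) (castQ (-1) 3 x)) τ = τ} ↦
      ∃ g : ℍ[ℚ,((-1 : ℤ) : ℚ),((3 : ℤ) : ℚ)], g ≠ 0 ∧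
        (∀ a : ℍ[ℚ,((-1 : ℤ) : ℚ),((3 : ℤ) : ℚ)], (a ∈ order (-1) 3 ∨ a - ⟨1/2, 1/2, 1/2, -1/2⟩ ∈ order (-1) 3) →
          ∃ b : ℍ[ℚ,((-1 : ℤ) : ℚ),((3 : ℤ) : ℚ)], (b ∈ order (-1) 3 ∨ b - ⟨1/2, 1/2, 1/2, -1/2⟩ ∈ order (-1) 3) ∧
            g * a = b * g) ∧
        0 < (g * star g).re ∧ (∃ s : ℚ, (g * star g).re = s ^ 2 ∨ (g * star g).re = 6 * s ^ 2) ∧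
        moebius (rho (-1) 3 (by norm_num) (castQ (-1) 3 g)) p.1 = q.1)) = 2 ∧
    Nat.card (Quot (fun p q : {τ : ℂ // 0 < τ.im ∧ ∃ x : ℍ[ℚ,((-1 : ℤ) : ℚ),((3 : ℤ) : ℚ)],
        x ∈ order (-1) 3 ∧ x.re = 0 ∧ (x * star x).re = ((25 : ℤ) : ℚ) ∧ moebius (rho (-1) 3 (by norm_num) (castQ (-1) 3 x)) τ = τ} ↦
      ∃ g : ℍ[ℚ,((-1 : ℤ) : ℚ),((3 : ℤ) : ℚ)], g ≠ 0 ∧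
        (∀ a : ℍ[ℚ,((-1 : ℤ) : ℚ),((3 : ℤ) : ℚ)], (a ∈ order (-1) 3 ∨ a - ⟨1/2, 1/2, 1/2, -1/2⟩ ∈ order (-1) 3) →
          ∃ b : ℍ[ℚ,((-1 : ℤ) : ℚ),((3 : ℤ) : ℚ)], (b ∈ order (-1) 3 ∨ b - ⟨1/2, 1/2, 1/2, -1/2⟩ ∈ order (-1) 3) ∧
            g * a = b * g) ∧
        0 < (g * star g).re ∧ (∃ s : ℚ, (g * star g).re = s ^ 2 ∨ (g * star g).re = 6 * s ^ 2) ∧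
        moebius (rho (-1) 3 (by norm_num) (castQ (-1) 3 g)) p.1 = q.1)) = 3 ∧
    Nat.card (Quot (fun p q : {τ : ℂ // 0 < τ.im ∧ ∃ x : ℍ[ℚ,((-1 : ℤ) : ℚ),((3 : ℤ) : ℚ)],
        x ∈ order (-1) 3 ∧ x.re = 0 ∧ (x * star x).re = ((75 : ℤ) : ℚ) ∧ moebius (rho (-1) 3 (by norm_num) (castQ (-1) 3 x)) τ = τ} ↦
      ∃ g : ℍ[ℚ,((-1 : ℤ) : ℚ),((3 : ℤ) : ℚ)], g ≠ 0 ∧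
        (∀ a : ℍ[ℚ,((-1 : ℤ) : ℚ),((3 : ℤ) : ℚ)], (a ∈ order (-1) 3 ∨ a - ⟨1/2, 1/2, 1/2, -1/2⟩ ∈ order (-1) 3) →
          ∃ b : ℍ[ℚ,((-1 : ℤ) : ℚ),((3 : ℤ) : ℚ)], (b ∈ order (-1) 3 ∨ b - ⟨1/2, 1/2, 1/2, -1/2⟩ ∈ order (-1) 3) ∧
            g * a = b * g) ∧
        0 < (g * star g).re ∧ (∃ s : ℚ, (g * star g).re = s ^ 2 ∨ (g * star g).re = 6 * s ^ 2) ∧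
        moebius (rho (-1) 3 (by norm_num) (castQ (-1) 3 g)) p.1 = q.1)) = 3 :=
  ⟨by
      have h := card_specialPoints_eq_two_mul_card_atkinLehnerQuotientSix_of_not (t := 1) (by norm_num)
        (not_exists_eq_mul_sq_of_not_dvd₁₃ (by norm_num))
      rw [card_specialPoints_table.1] at h; omega,
    by
      have h := card_specialPoints_eq_two_mul_card_atkinLehnerQuotientSix_of_not (t := 3) (by norm_num)
        (not_exists_eq_mul_sq_of_not_dvd₁₃ (by norm_num))
      rw [card_specialPoints_table.2.1] at h; omega,
    by
      have h := card_specialPoints_add_two_eq_two_mul_card_atkinLehnerQuotientSix_of_sq_mul (t := 6) (by norm_num) (m := 1) (by norm_num)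
      rw [card_specialPoints_table.2.2.1] at h; omega,
    by
      have h := card_specialPoints_eq_two_mul_card_atkinLehnerQuotientSix_of_not (t := 10) (by norm_num)
        (not_exists_eq_mul_sq_of_not_dvd₁₃ (by norm_num))
      rw [card_specialPoints_table.2.2.2.1] at h; omega,
    by
      have h := card_specialPoints_eq_two_mul_card_atkinLehnerQuotientSix_of_not (t := 13) (by norm_num)
        (not_exists_eq_mul_sq_of_not_dvd₁₃ (by norm_num))
      rw [card_specialPoints_table.2.2.2.2.1] at h; omega,
    by
      have h := card_specialPoints_eq_two_mul_card_atkinLehnerQuotientSix_of_not (t := 19) (by norm_num)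
        (not_exists_eq_mul_sq_of_not_dvd₁₃ (by norm_num))
      rw [card_specialPoints_table.2.2.2.2.2.1] at h; omega,
    by
      have h := card_specialPoints_eq_two_mul_card_atkinLehnerQuotientSix_of_not (t := 21) (by norm_num)
        (not_exists_eq_mul_sq_of_not_dvd₁₃ (by norm_num))
      rw [card_specialPoints_table.2.2.2.2.2.2.1] at h; omega,
    by
      have h := card_specialPoints_eq_two_mul_card_atkinLehnerQuotientSix_of_not (t := 22) (by norm_num)
        (not_exists_eq_mul_sq_of_not_dvd₁₃ (by norm_num))
      rw [card_specialPoints_table.2.2.2.2.2.2.2.1] at h; omega,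
    by
      have h := card_specialPoints_eq_two_mul_card_atkinLehnerQuotientSix_of_not (t := 25) (by norm_num)
        (not_exists_eq_mul_sq_of_not_dvd₁₃ (by norm_num))
      rw [card_specialPoints_table.2.2.2.2.2.2.2.2.1] at h; omega,
    by
      have h := card_specialPoints_eq_two_mul_card_atkinLehnerQuotientSix_of_not (t := 75) (by norm_num)
        (not_exists_eq_mul_sq_of_not_dvd₁₃ (by norm_num))
      rw [card_specialPoints_table.2.2.2.2.2.2.2.2.2] at h; omega⟩

end Tables

end Literature.Geometry.Kaehler.ComplexTorus.QuaternionType
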